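import Mathlib
import HarnessLib
import HarnessLib.Audit
import Summits.BirchSwinnertonDyer.Statement
import Summits.BirchSwinnertonDyer.BirchSwinnertonDyer.Theorems.SchneiderFreeSockets
import Summits.BirchSwinnertonDyer.BirchSwinnertonDyer.Theorems.SchneiderFreeSocketsV2
import Literature.NumberTheory.EllipticCurves.NonvanishingTwistsPrescribedSplitting
import HarnessLib.Audit.Status.Attr

/-!
Route: SchneiderFreeAdditiveX3

# Route SchneiderFreeAdditiveX3 — Height-free BDP door for the lower half of BSD_p on B6's reducible
semistable-twist cells

It suffices to show STEP L at an additive potentially-ordinary prime on the reducible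
semistable-twist cells of row B6 — for every
globally minimal `E/ℚ` with `r_an(E) = 1`, every odd additive `p` with `E[p]` reducible (`ClassX3`)
and `E^{(p*)}` semistable at `p`
(`SubSemistableTwist` = (M) ∪ (G-ord, `e = 2`)), and every Heegner datum over a Heegner field `K`
(all `ℓ ∣ N` split, so `p` split;
odd `d_K`, `p ∤ #𝓞_K^×`, `L(E^{d_K},1) ≠ 0`; ANY parametrisation datum, its constant `c` — `c·Λ_f ⊆
Λ_E` — carried as a slack and
NO Manin hypothesis `p ∤ c`, rev 3), the Jetchev–Skinner–Wan inequality `2·ord_p[E(K):ℤP_K] ≤ ord_p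
#Ш(E/K) + 2·ord_p ∏ c_ℓ + 2·v_p(c)`
(`SchneiderFree.IndexLowerBoundLeAt W p K P (v_p c)`; at `p ∤ c` it is `X11b.IndexLowerBoundAt`) —
obtained WITHOUT any `p`-adic height from three typed inputs: the door-direction branch
Greenberg/BDP main conjecture composed with the Liu–Zhang–Zhang value on (M) (`PotMultBranchIMC`,
NONE) and on (G-ord, `e = 2`)
(`GordTwoBranchIMC`, PRE: Keller–Yin 2410.23241 Thm. 3.5.1) — both losing exactly `2·v_p(c)`,
because the BDP value is intrinsic to
the newform — and the additive anticyclotomic control equality (`AnticycControlAdditive`, DERIVED;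
`c`-free). X = `StepLManin`;
Gross–Zagier bookkeeping WITH the constant kept (`JointLowerManin`: `#Ш_an(E)·#Ш_an(E^{d_K}) ∝
([E(K):ℤP]/c)²`, so the `2·v_p(c)`
CANCEL), the Heegner/twist data (`HeegnerTwistData`), the printed facts (`PrintedFacts`) and the
TREE upper half of the rank-zero twist
(`PartnerUpperRankZero` = `Additive.ClassX3.missingUpperBoundAt_rankZero_of_subSemistableTwist` from
`PrintedFacts`) turn X into the rung leaf
`Summit.BirchSwinnertonDyer.BirchSwinnertonDyer.Theorems.SchneiderFree.AdditiveX3RankOneLower`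
(D-0061 `closes_target`; = the lower half of BSD_p on X3 ∧ semistable twist ∧ `r_an = 1`, a slice of
`Additive.O7.LowerHalf` by `additiveX3RankOneLower_of_o7LowerHalf`).
Lean: `∀ (W : WeierstrassCurve ℚ) [W.IsElliptic] [W.IsGloballyMinimal] (p : ℕ) [Fact p.Prime],
W.analyticRank = 1 → p ≠ 2 → Literature.NumberTheory.EllipticCurves.Rank1Residual.ClassX3 W p →
Summit.BirchSwinnertonDyer.Rank1Residual.Additive.SubSemistableTwist W p →
Summit.BirchSwinnertonDyer.BirchSwinnertonDyer.Theorems.SchneiderFree.AdditiveStepLInputManinAt W p`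

## Assembly
Pure logic (kernel-checked in `RenderSimV16.lean` as `closes`, 0 sorries, decls in gate render
order, on the in-tree sockets v1 + v2): `StepLManinLink` turns the
three cruxes into `StepLManin`; `HeegnerTwistData` supplies `(N, K, Dt, H, ι, P, Wd)` with NO
condition on `Dt.c`; the cells lie in
`Additive.N10.Locus` (`N10.cellM_or_cellGordTwo_of_classX3_of_subSemistableTwist`,
`N10.locus_iff_cells`); `StepLManin` gives
`IndexLowerBoundLeAt W p K P (v_p Dt.c)`; `JointLowerManin` (fed the first seven conjuncts of `hF :
PrintedFacts`) gives `JointLowerBoundAt W Wd p`; `PartnerUpperRankZero` (fed its six) gives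
`MissingUpperBoundAt Wd p`; `HeegnerTwistData` is fed its six;
`Typed.missingLowerBoundAt_of_joint_of_upper` concludes `MissingLowerBoundAt W p`, i.e. the leaf.
The deciding theorem is `closes` (v16/glue.lean, 8 binders = `PrintedFacts` + 3 analytic cruxes +
the GZ-bookkeeping crux + 3 supports,
all consumed); the `Assembly` item below is the same implication as a Prop, not a binder of
`closes`.

CLOSES_TARGET: closes rung K1 of BirchSwinnertonDyer: Summit.BirchSwinnertonDyer.BirchSwinnertonDyer.Theorems.SchneiderFree.AdditiveX3RankOneLower (D-0061; not the summit Statement) — the deciding theorem of this route concludes that registered leaf instead of the Statement decl `BirchSwinnertonDyer` (class rung: servable and labelled, never counted as concluding the summit Statement).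

Rationale: WHY THIS LINE. On the cyclotomic road the rank-one `p`-part of BSD at these 7 101 pairs (6 794 at `p
= 3`) is «certificate-shaped modulo Schneider»: Perrin-Riou/Schneider's leading-term formula sees
the rank only through the cyclotomic `p`-adic height, whose class-wide non-degeneracy is open
(barrier `PAdicHeightNondegeneracy`). The anticyclotomic BDP value at the trivial character is
`log_ω(y_K)²` (Liu–Zhang–Zhang, Duke 2018 = arXiv:1511.08172 Thm. 1.8, valid at additive `p` with
`𝔭` split) — a LOGARITHM, non-zero iff the Heegner point is non-torsion (tree
`X11b.R1.logOmega_eq_zero_iff`) — so the door needs no height. At an additive Eisenstein `p` the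
branch mechanism (Heegner pair `(f̃, χ_ε)`, `f_E = f̃ ⊗ ε`) is in print on the potentially-good `e =
2` cell as an EQUALITY (Keller–Yin arXiv:2410.23241 Thm. 3.5.1, Oct 2024, PRE; inputs JLZ21 PLMS
122, Kriz16, Rubin91, BDP13, CH18, KY24 = 2402.12781) and named open by the same authors on the
potentially-multiplicative cell (p. 15); the partner's upper half is a tree theorem from Delbourgo
1998 Prop. 4 + Wuthrich 2014 with NO image hypothesis. Imported from: anticyclotomic Iwasawa theory
(Greenberg Selmer groups over `K_∞^{ac}`, BDP `p`-adic `L`-functions), `p`-adic Waldspurger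
formulae. What it does that the existing roads do not: removes the Schneider rider AND the analytic
`p`-adic Gross–Zagier input (K1′) from the lower half on these cells (memo
`pub/bsd-schneider-ideate/memos/ROUTE-P2.md` v5 L11, L38, L69–L77; `memos/ROUTE-P2.v4.md` §3 for the
road-by-road «around» survey L10–L17). REVS 12–14 (what the door seats PROVED, and why the leaf is
now TWO cruxes): STEP L consumes the control corner only one-sidedly — `ord_p f_ac^∅(0) ≤ ord_p
#Ш(E/K)[p^∞] + 2(ord_p log_ω P − ord_p[E(K):ℤP]) + ord_p ∏_w c_w(E/K)`, i.e. `#Sel ≤ #(Λ/f)_Γ ·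
(torsion atoms ≤)` — and that INEQUALITY, together with CTL₀ (`X_ac^∅(E_K[p^∞])` is `Λ`-torsion with
`f(0) ≠ 0`), holds at EVERY frame of the door (any global `p`-torsion `g`, any local `t_p`, both
cells, no Fin_v) from Poitou–Tate duality for Selmer structures (Milne ADT I.4.10(b) =
`ControlFacts.1`) and Kolyvagin (`PrintedFacts.2.1`) ALONE: tree
`Theorems/SchneiderFreeAdditiveX3ControlLeDoor.lean` (p447721) + `…ControlLeMinimal.lean` (p448348),
whose `stepLManin_of_pt_of_kolyvagin_of_branchIMCs` is item `StepLManinLinkLe` (CLOSED by name) and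
whose `additiveX3RankOneLower_of_printedFacts_of_pt_of_typedHalves` is the door's complete residual
in one statement: the leaf ⇐ `PrintedFacts` + one duality + the typed analytic halves H1/H2/H3
(`Theorems/SchneiderFreeAdditiveX3Defs.lean`: `BranchBDPExistsAt`, `BranchBDPValueLeAt`,
`BranchIMCDivAt`) on the two cells. The control EQUALITY (`AnticycControlAdditive` and its
descendants, ranks 4–6) is therefore an exact-count RECORD off the leaf's critical path (referee g24
PASS «r4/r5 OFF the leaf critical path»; the 2·3^g torsion twist of P2 g8's CONTROL-tp memo is
settled there and never touches the leaf). Negatives index: no refuted statement of the summit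
concerns additive anticyclotomic control or branch main conjectures (re-read 2026-08-26).

RANKED CRUXES. #0 StepLManin (target, OPEN) — STEP L, MANIN-ROBUST (rev 3 / repair R1): the JSW17
(eq:shalowerK-1) inequality over the Heegner field with the parametrisation constant carried as a
slack, `2·ord_p[E(K):ℤP_K] ≤ ord_p #Ш(E/K) + 2·ord_p ∏ c_ℓ + 2·v_p(c)`
(`SchneiderFree.IndexLowerBoundLeAt W p K P (v_p Dt.c)`), for every pair on the cells and EVERY
Heegner/parametrisation datum (no `p ∤ c`) — the socket `AdditiveStepLInputManinAt W p` on `r_an = 1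
∧ p ≠ 2 ∧ ClassX3 ∧ SubSemistableTwist`. Since rev 13 it follows from the two branch cruxes ALONE
modulo print: `StepLManinLinkLe` (item 19653, CLOSED by
`stepLManin_of_pt_of_kolyvagin_of_branchIMCs`) = Poitou–Tate duality → Kolyvagin → PotMultBranchIMC
→ GordTwoBranchIMC → StepLManin. [deps: PotMultBranchIMC, GordTwoBranchIMC] [difficulty: XL] (why it
might fail: it is exactly as strong as the two branch cruxes; at `e ∈ {3,4,6}` (excluded here) no
format exists at all; the slack is sharp only if the BDP side loses no more than `2·v_p(c)`.)
[arXiv:1512.06894, arXiv:2410.23241, arXiv:1511.08172, arXiv:1911.09446]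
#2 PotMultBranchIMC (crux, OPEN, vetted; 4 541 pairs = 64 % of the door) — on the potentially
MULTIPLICATIVE reducible cell (M) with `r_an = 1`: for every Heegner/parametrisation datum and every
anticyclotomic frame `(κ, γ, 𝔭)` with `𝔭 ∣ p` of degree one, a generator `f` of `char_Λ
X_Gr(E/K_∞^{ac})` (strict at `𝔭`, relaxed at `𝔭̄`, tree `XAc … ∅`) has `2·ord_p log_ω P ≤ ord_p f(0)
+ 2·v_p(c)` — the door direction `𝓛^{BDP} ∣ char` at 𝟙 composed with the value at 𝟙: T-B6-1♯
Manin-robust, `AdditiveIMCLowerBDPInputManinAt` on SubM. LAYER 2 (registered skeleton v4 «typed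
halves, facts-only» on item 19176, door-c2 g5, composition
`potMultBranchIMC_of_pt_of_kolyvagin_of_typedHalves hCF.1 hF.2.1`): `stub_bdpExistsSubM` = H1|M (a
BDP frame for the datum's newform at `p² ∣ N`, via `W = W′ ⊗ χ_{p*}`, `W′` multiplicative at `p`, on
the `χ_ε`-branch of conductor `p`: Castella 2018 Thm. 3.1 / CH18 Prop. 3.8 CONSTRUCTION extended to
`p ‖ N′` — stated in print by no one), `stub_bdpValueLeSubM` = H2|M (the value at the conductor-`p`
genus character against THE datum's Heegner point: CH18 Lemma 5.4 / Thm. 5.7 shape at `p ‖ N′` — not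
in print), `stub_imcDivSubM` = H3|M (`Ch_Λ(X_ac^∅)·R₀⟦T⟧ ⊆ (L)` for `f̃` multiplicative Eisenstein
on the `χ_ε`-branch — NOTHING in print; Keller–Yin name it open, arXiv:2410.23241 p. 15). Every
other input of the (M) road is landed (door-c2 g0–g5, all `--supports 19176`: lattice transport
p438914 + currency KF p438916, isogeny transport p442145/p442424, Tate line character p450326 +
canonical line p451736 (Fin_v on (M) from Tate uniformisation), LocalTowerTorsionFiniteOfFacts
p452324/p455665, PotMultBranchIMCOfFacts p454376). [difficulty: open-problem] (why it might fail: no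
divisibility toward X_Gr is in print for `f̃` multiplicative Eisenstein on the `χ_ε`-branch; KY24's
Hida argument (Thm. 5.1.3, `p ‖ N`) may not survive the twist (specialisation at 𝟙 off the family;
`μ` at `p = 3`); one frame with `Ch ⊄ (L)` refutes H3|M.) [arXiv:2402.12781, arXiv:2410.23241,
arXiv:1511.08172, arXiv:2303.04373, arXiv:1704.06608]
#3 GordTwoBranchIMC (crux, OPEN, vetted; 2 560 pairs, 2 411 at `p = 3`) — the same on the
potentially GOOD ordinary `e = 2` reducible cell, `AdditiveIMCLowerBDPInputManinAt` on SubGordTwo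
(slack `2·v_p(c)`, no `p ∤ c`). LAYER 2 (registered skeleton v3 «typed-halves» on item 19177,
composition `gordTwoBranchIMC_of_pt_of_kolyvagin_of_typedHalves`): `stub_bdpExistsSubG` =
H1|SubGordTwo and `stub_bdpValueLeSubG` = H2|SubGordTwo — DERIVABLE FROM PRINT along door-c3's
rebased road `W = W′ ⊗ χ_{p*}`, `W′` good ordinary at `p`, `p ∤ N′` (landed, all `--supports 19177`:
Rebase p429109/p429180, RebaseIndex p431924, RebaseSocket p432554, TwistUntwistHeights p450882 +
RebaseHeight p450981 (the height transport `‖P_χ‖² = 2‖y_{1,K}‖²`, link (L2) a theorem),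
RebaseCovolume p451460, RebaseGenus p453353 («(L3) discharged: H = K(√p*) = K·ℚ(√p*)»), the twist
identity `L(f̃/K, ε_Kξ) = L(f_E/K, ξ)`; in progress door-c3 g6: the Artin link (L1) from the tree
fact `Gross2004.rankinLSeries_eq_mul_quadraticTwist`) modulo THREE cite-only facts wanted from the
typer — CH18 Def. 3.7 + Prop. 3.8 (existence/interpolation at `p`-power conductor, wi-73259), CH18
Lemma 5.4 + Thm. 5.7 (the value formula at a ramified character of conductor `p^n`, `n ≥ 1`,
wi-73260), the genus datum `√p* ∈ K[p]` (Cox 9.18/6.1, Gross 1987 §§2–3, wi-73261), in the currency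
`defn-BranchBDPLFunction` (`IsBDPLFunctionPPow`); `stub_imcDivSubG` = H3|SubGordTwo = item 19662
`GordTwoBranchIMCDivX3` BY NAME (Keller–Yin 2410.23241 Thm. 3.5.1 `Char_Λ(𝔛)Λ^{ur} = (𝓛_ε)` for the
Heegner pair, Case (I) `p ∤ N′`, `p` split, `p > 2`, read at the frame — PREPRINT, the route's
research-grade residual on this cell; hypothesis audit (G1)–(G6) = evidence n=7 on 19177).
[difficulty: XL] (why it might fail: two preprint layers (KY24b resting on KY24 and on an in-proof
generalisation of JLZ21's Heegner cycles); LV16/CGLS-type `p ∤ 6N′` hypotheses at `p = 3` dropped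
silently (2 411 of the 2 560 pairs); lattice/isogeny choice `φ|_{G_p} ≠ 𝟙` — ⊇ is isogeny-robust
only given `μ = 0` on one lattice (p442145).) [arXiv:2410.23241, arXiv:2402.12781, arXiv:1505.08165,
arXiv:1511.08172]
SUPPORTS ON THE LEAF PATH (binders of `closes`): #9 PrintedFacts (item 19184, facts binder, thirteen
named published facts VERBATIM in print — GZ86 I.(6.3) `gross_zagier`, Kolyvagin, GZK, modularity, a
parametrisation datum, Cassels, GZ86 I.(7.3), Friedberg–Hoffstein Thm. B with prescribed splitting,
parity, Heegner points over `K`, Delbourgo 1998 Prop. 4, Wuthrich 2014 Thm. 16 half + component;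
closes only by formalisation; `closes` destructures it) · #9 ControlFacts (item 19538, facts binder:
Poitou–Tate Selmer-structure duality, Poitou–Tate Ш-duality, Brink 2007 Thm 2 / Cor 1; `closes` uses
ONLY conjunct 1) · #9 StepLManinLinkLe (19653, CLOSED) · #9 HeegnerTwistData (19183, CLOSED,
p418937: the Heegner field with `2p` split, the datum, the non-torsion traced point, the twist's
minimal model on the same cells with `r_an = 0`, from six printed facts) · #9 JointLowerManin
(19180, CLOSED, p418842: GZ bookkeeping with the constant kept — the `2·v_p(c)` CANCEL, FINDING
cacd1ba6) · #9 PartnerUpperRankZero (19181, CLOSED: the tree upper half of the rank-zero twist) · #1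
Assembly (19182, CLOSED; the rev-3 eight-binder implication as a Prop, informational).
CONTROL CORNER = EXACT-COUNT RECORD (NOT on the leaf path since rev 13; kept because every piece is
a theorem or one named fact away): #4 AnticycControlAdditive (19178, the rev-3 equality, fact-free,
F2-under-typed — superseded as a target by) #4 AnticycControlAdditiveK (19295, `kolyvagin →` form)
and #4 AnticycControlAdditiveKF (19548, `‹ControlFacts conjuncts› → kolyvagin → equality at every
frame`; its proof = the three global-`p`-torsion regimes A/B1/B2 — ControlNoLocalPTorsionF 19544,
ControlNoGlobalPTorsionF 19545, ControlGlobalPTorsionF 19547, all CLOSED — composed by p442095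
`…AnticycControlAdditiveKFOfRegimes` GIVEN Fin_v on the cells; NOT closable as typed without local
CFT (i), dead end recorded by P2 g11, hence the F-records); #5 LocalTowerTorsionFiniteX3 (19546,
Fin_v on the cells: (M) half PROVED from Tate uniformisation p450326/p451736; (G-ord) half reduced
to the ordinary unit-root line, p455995/p457099/p457112) and its F-records #5
LocalTowerTorsionFiniteX3F (19668) / #5 AnticycControlAdditiveKFF (19669) = `(∀ K p,
ZpExtension.exists_isFrobPow_mem_kerSubgroup_of_isAnticyclotomic K p) → …` (local CFT (i), cite-only
p443291), whose closers are LANDED one-liners (p457465 `…F_of_lineCharacterRat`, p457466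
`…F_of_unitRoot`) pending ONE unconditional file (the ordinary-line unit-root character `φψ⁻¹ =
χ_cyc` on `V[p^k]/C_v`, Greenberg LNM 1716 §2 p. 70; door-c4 g5 (1a) + door-c5 g6 (1b) in progress).
Older links kept CLOSED as records: StepLManinLinkR (19263), and StepLManinLink (19179, rev-3 form,
open, superseded). ASIDES (never staffed): StepLManinK, AdditiveControlLeaf,
AdditiveIMCLowerBDPLeaf, MultPublishedInputsAtTwo and the nine single-fact asides
19266/19273/19296/19306/19307/19369/19449/19450/19921.

TWO-LAYER PLAN. Layer 2 of BOTH cruxes is fixed and registered: r3 `GordTwoBranchIMC ⇐ H1|SubGordTwo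
→ H2|SubGordTwo → H3|SubGordTwo (= item 19662)` (skeleton v3, composition kernel-checked, facts
`ControlFacts.1` + Kolyvagin); r2 `PotMultBranchIMC ⇐ H1|M → H2|M → H3|M` (skeleton v4). Layer-2
RECORD ITEMS for the print-derivable halves (H1|SubGordTwo, H2|SubGordTwo; later H1|M, H2|M) are
filed by the base unit ONLY as the exact types of landed theorems `<half>_of_facts : F₁ → … → F_k →
‹half, unfolded›` whose antecedents are NAMED cite-only Literature facts (pattern of 19653 / 19668 /
19669: closable by name) — never fact-free (F2-class rule: a statement whose in-tree proof must
consume a cite-only fact is filed with the fact as antecedent). The control corner's decomposition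
(regimes A/B1/B2 by global `p`-torsion, Fin_v by cell) is complete and landed.

KILL CRITERIA. A frame on the (G-ord, `e = 2`) cell with `Ch_Λ(X_ac^∅)·Λ^{ur} ⊄ (𝓛_ε)` (a
counterexample to Keller–Yin's equality, e.g. `μ(𝓛_ε) > μ(X)` on the branch at `p = 3` where
LV16/CGLS's `p ∤ 6N′` is dropped) refutes item 19662 and with it `GordTwoBranchIMC`: the route
retreats to (M) (`closes` re-glued on `PotMultBranchIMC` with the leaf restricted to SubM as a new
rung target) or closes `refuted:GordTwoBranchIMC`. A refutation of `PotMultBranchIMC` (one (M) frame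
where the BDP side loses MORE than `2·v_p(c)`, or a branch with `Ch ⊄ (L)`) closes the route
`refuted:PotMultBranchIMC` unless the (G-ord) half is split off as its own route (package ready: the
leaf restricted to SubGordTwo). A refutation of a control-corner RECORD item no longer breaks the
leaf (not a binder of `closes`) — it is repaired or dropped as a record. Proved elsewhere that moots
the route: `Additive.O7.LowerHalf` or `X3Sharp` (b2b-bsdres) on these cells; KY24/KY24b PUBLISHED
with the hypotheses as audited turns r3 into «print + typer facts».

NOT DECOMPOSED YET. Inside H1|SubGordTwo / H2|SubGordTwo: nothing — the road is landed modulo the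
three typer facts and (L1) (door-c3 g6). Inside item 19662 (KY24b Thm. 3.5.1): the ANATOMY of the
preprint proof — which steps are published inputs (JLZ21, Kriz16, BDP13, CH18, Rubin91), which rest
on KY24 (2402.12781, PRE), which are new — is the base unit's next deliverable (P2 g12), as a
registered line on 19177/19662, so that «verify KY as OUR theorem» has typed sub-targets. Inside the
(M) halves: everything analytic (no print); the algebraic side is landed.

CHEAPEST FALSIFIER. Given the PROVED control corner, each branch crux at a pair is numerically
EQUIVALENT to STEP L there (`2·ord_p log_ω P ≤ ord_p f(0) + 2·v_p(c)` ⟺ `2·ord_p[E(K):ℤP] ≤ ord_p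
#Ш(E/K) + 2·ord_p ∏ c_ℓ + 2·v_p(c)` by the exact count), so the one cheap check is STEP L pair by
pair: for the first twenty SubGordTwo and the first twenty SubM pairs of
`memos/census-P2-g4/h0census.tsv.gz` (all `p = 3`), over the Heegner field with `6` split, compute
`y_K` (`ellheegner` + the trace), `[E(K):ℤP]` from Néron–Tate heights, `#Ш_an(E)·#Ш_an(E^{d_K})` and
the Tamagawa numbers from ecdata/LMFDB, and `v_3(c) = 0` (census j246813): ONE pair with
`2·ord_3[E(K):ℤP] > ord_3(#Ш_an(E)·#Ш_an(E^{d_K})) + 2·ord_3 ∏ c_ℓ` refutes the target on that cell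
and hence the cell's crux (or BSD itself). One `kit pari` job for all forty pairs; NOT run yet
(recommended to the referee/kit seat; the census jobs j243439/j246813/j248537 only located and
classified the pairs). For item 19662 alone no cheap falsifier exists short of computing `μ/λ` of
`𝓛_ε` on a branch, which needs CH18's measure for `f̃` — out of seat scope.

NUMBERS. B6 = 11 505 pot-ordinary `r = 1` S-b pairs (`N < 5·10⁵`); cells of this route: X3 ∧ (M) 4
541 + X3 ∧ (G-ord, `e = 2`) 2 560 = 7 101 (61.7 %), of which 6 794 at `p = 3`; `t_p = 1` on 4 981 of
them (3 256 + 1 725); global 3-torsion over `K` on the 3-torsion members of 64.4 % of the `p = 3` X3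
isogeny classes (kit j248537; every class also has an `E(K)[3] = 0` member); `3 ∤ c_3` on all;
Keller–Yin's regime `p > 2`, `p ∤ N′` ⟺ `e = 2`; Manin/lattice census (kit j246813): 7 339 X3 pairs,
7 714 `p`-power-isogenous class members, `α(E_opt → W) = 1` for all, 0 with `p ∣ α`. Sources:
`run/shared/lean/b2b/bsd-rank1-residual/b2b-bsdres-rmap-2/census/corner_split_rmap2g2.json`, kit
j243439, j246813, j248537.

DEFINITION REQUESTS. LIVE: `defn-BranchBDPLFunction` (notions `IsBDPLFunctionPPow` /
`IsBranchBDPLFunction`: a BDP-type `p`-adic `L`-function on a branch of `p`-power conductor,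
Castella–Hsieh Math. Ann. 370 (2018) Def. 3.7 currency) and the three cite wants wi-73259 (CH18 Def.
3.7 + Prop. 3.8), wi-73260 (CH18 Lemma 5.4 + Thm. 5.7), wi-73261 (genus datum `√p* ∈ K[p]`, Cox Thm.
9.18 / 6.1, Gross 1987 §§2–3) — payloads
`pub/bsd-schneider-ideate/memos/route-P2-D0059/rev12/cite{1,2,3}_payload.json`; Liu–Zhang–Zhang 2018
Thm. 1.8 at an additive `p` with `𝔭` split as a Literature fact (optional: H2 is now routed through
CH18 Thm. 5.7 on the rebased curve). SETTLED: both sockets files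
(`Theorems/SchneiderFreeSockets.lean`, `…SocketsV2.lean` sha16 654fbe9b7e0b9379), the control atoms,
the route Defs (`Theorems/SchneiderFreeAdditiveX3Defs.lean`, H1/H2/H3 predicates) are IN TREE; the
Friedberg–Hoffstein cite item of 2026-08-25 is REDUNDANT (tree fact
`friedbergHoffstein_exists_heegnerField_splitDivisors_twist_ne_zero`). NEVER a fact: Keller–Yin
2410.23241 Thm. 3.5.1 (item 19662) and KY24 2402.12781 (PRE) — items/cruxes only (referee S5).

Novelty: Searches (2026-08-25): lit search --hybrid «potentially good ordinary Eisenstein p-converse» (hit: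
arXiv:2410.23241), «Heegner pair
twisted BDP main conjecture» (2410.23241, 2402.12781), «Kohen Pacetti anticyclotomic additive»
(arXiv:1801.01619, 1505.08059),
«anticyclotomic main conjecture additive reduction divisibility» (no divisibility hit), «Kolyvagin
bound non-surjective small image»
(Cha 2005); lit galaxy search --star all «Heegner pair|potentially good ordinary» (0 pertinent
beyond the above), «Cerednik-Drinfeld»
(8 panama volumes, none at additive p); crossref «Kohen Pacetti main conjecture» (8 rows, no
sequel); OpenAlex/S2 HTTP 429 today.
Nearest prior art found: arXiv:2410.23241 (Keller–Yin: `p`-converse at pot-good ordinary Eisenstein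
`p` via the Heegner pair —
proves RANK statements, not the BSD formula; supplies crux 3's equality), arXiv:1801.01619
(Kohen–Pacetti: definite anticyclotomic
`L` at SRAE additive `p`, no divisibility), arXiv:1512.06894 (JSW17: the formula road at GOOD `p`).
Delta: the BSD-FORMULA lower half at an ADDITIVE Eisenstein prime assembled height-free from the
branch main conjecture + the
`p`-adic Waldspurger value + an additive control theorem, with the partner's upper half taken from
the tree's image-free X3 theorem.
Evidence re-run (2026-08-25 g5, BC2/BC8 labelling rule, corpus fts+vec AND galaxy): nearest PRINT
result on the `p`-part
of BSD at an ADDITIVE prime in analytic rank 1 is CM-only — Li–Tian–Yan–Zhu 2025, Thm. 1.1 (`E` with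
CM by  [refs: 2410.23241, 1801.01619, 1512.06894, arxiv-2410.23241, arxiv-2008.02571, arxiv-1704.06608, paper-arxiv-2409.01350]

Barriers (technique_class: anticyclotomic-iwasawa, heegner-points, eisenstein-congruence): - technique_class: anticyclotomic-iwasawa, heegner-points, eisenstein-congruence
- Literature.Barriers.BirchSwinnertonDyer.HeegnerPointBarrier: INSIDE its class, inside its
permitted regime — every crux and the leaf
  carry `W.analyticRank = 1` (`HeegnerTwistChoice` adds `L(E^{d_K},1) ≠ 0`, so `r_an(E/K) = 1` and
the Heegner point is non-torsion by
  Gross–Zagier); the barrier quantifies over `2 ≤ W.analyticRank` only; the route claims nothing in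
rank ≥ 2 (recorded dead end: the
  derived-height road needs anticyclotomic maximal non-degeneracy, arXiv:2308.10474).
- Literature.Barriers.BirchSwinnertonDyer.HeegnerPointBarrierNarrow: same placement — the point
supply IS the bottom Heegner class
  `c(1) = δ y_K` (datum `P` of `HeegnerTwistChoice`, level `N_E`, classical Heegner hypothesis),
used exactly where the Narrow entry
  permits it (`r_an(E/K) = 1`); the Selmer-level Kolyvagin systems inside `BranchMCPotMult` /
`BranchMCPotGoodTwo` are, by the entry's
  own correction, outside its class.
- Literature.Barriers.BirchSwinnertonDyer.AnticyclotomicHeightDegeneracy: evaded — OUTSIDE its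
class: no anticyclotomic HEIGHT
  (degenerate in odd rank, `det_gramMatrix_eq_zero_of_odd`; `E(K)` has odd rank 1 here) is used; the
cruxes read the BDP `p`-adic
  `L`-function OUTSIDE its interpolation range, where its value is a logarithm `log_ω P`, not a
height (arXiv:1505.08165)
  [corpus:arxiv-2409.01350 p.9].
- Literature.Barriers.BirchSwinnertonDyer.AnticyclotomicHeightDegeneracyNarrow: ev

History (route lifecycle, newest last):
- 2026-08-26T01:23:55Z · rev 3: restated StepLOnCells (stmt-BirchSwinnertonDyer-18966), BranchMCPotMult (stmt-BirchSwinnertonDyer-18967), BranchMCPotGoodTwo (stmt-BirchSwinnertonDyer-18968), AdditiveAnticycControl (stmt-BirchSwinnertonDyer-18969), StepLLink (stmt-BirchSwinnertonDyer-18970), JointLowerOfStepL (stmt-BirchSwinnertonDyer-18972), P (planner-bsd-schneider-ideate-P2-g7-0)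
- 2026-08-26T01:23:55Z · rev 3: dropped HeegnerTwistChoice — rev 3: repair R1 = Manin-robust sockets v2 (director-bsd 2026-08-25T23:23:34Z; referee g17 PASS of v1.5; FINDING cacd1ba6): the eight rev-2 items restated onto (planner-bsd-schneider-ideate-P2-g7-0)
- 2026-08-26T04:22:27Z · AUTO-CRUX (edit): AnticycControlAdditiveK — hypotheses of the deciding theorem that nothing in the route derives are cruxes (planner-bsd-schneider-ideate-P2-g8-0)

sub-problem: BirchSwinnertonDyer · status: open · opened planner-bsd-schneider-ideate-P2-g5-0 2026-08-25T21:07:29Z · rev 15 · ledger route-BirchSwinnertonDyer-SchneiderFreeAdditiveX3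
GENERATED by the gate from the ledger (D-0016/17). Provers cite these decls: `theorem foo : Summit.BirchSwinnertonDyer.BirchSwinnertonDyer.Theses.SchneiderFreeAdditiveX3.<Decl> := …` in Summits/BirchSwinnertonDyer/BirchSwinnertonDyer/Theorems/<Name>.lean.
-/

namespace Summit.BirchSwinnertonDyer.BirchSwinnertonDyer.Theses.SchneiderFreeAdditiveX3

open scoped BigOperators Topology Manifold Classical MeasureTheory ProbabilityTheory Matrix InnerProductSpace ComplexConjugate ContinuousMap
open Filter Set Function TopologicalSpace MeasureTheory

attribute [summit_statement] _root_.BirchSwinnertonDyer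
attribute [summit_statement] _root_.Summit.BirchSwinnertonDyer.BirchSwinnertonDyer.Theorems.SchneiderFree.AdditiveX3RankOneLower

open Literature

/-- item stmt-BirchSwinnertonDyer-19175 · target · rank 0 · open · by planner
why it might fail: it is exactly as strong as its three inputs below; at `e ∈ {3,4,6}` (excluded here) no format exists at all; the slack is sharp only if the BDP side really loses no more than `2·v_p(c)`.
sources: arXiv:1512.06894, arXiv:2410.23241, arXiv:1511.08172, arXiv:1911.09446
[target] STEP L, MANIN-ROBUST (rev 3 / repair R1): the JSW17 (eq:shalowerK-1) inequality over the
Heegner field with the parametrisation constant carried as a slack, `2·ord_p[E(K):ℤP_K] ≤ ord_p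
#Ш(E/K) + 2·ord_p ∏ c_ℓ + 2·v_p(c)` (`SchneiderFree.IndexLowerBoundLeAt W p K P (v_p Dt.c)`), for
every pair on the cells and EVERY Heegner/parametrisation datum (no `p ∤ c` hypothesis) — the socket
`AdditiveStepLInputManinAt W p` on `r_an = 1 ∧ p ≠ 2 ∧ ClassX3 ∧ SubSemistableTwist`. [deps:
PotMultBranchIMC, GordTwoBranchIMC, AnticycControlAdditive] [difficulty: XL] -/
@[route_item "route-BirchSwinnertonDyer-SchneiderFreeAdditiveX3"]
def StepLManin : Prop :=
  ∀ (W : WeierstrassCurve ℚ) [W.IsElliptic] [W.IsGloballyMinimal] (p : ℕ) [Fact p.Prime], W.analyticRank = 1 → p ≠ 2 → Literature.NumberTheory.EllipticCurves.Rank1Residual.ClassX3 W p → Summit.BirchSwinnertonDyer.Rank1Residual.Additive.SubSemistableTwist W p → Summit.BirchSwinnertonDyer.BirchSwinnertonDyer.Theorems.SchneiderFree.AdditiveStepLInputManinAt W p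

/-- item stmt-BirchSwinnertonDyer-19176 · crux · rank 2 · open · by planner
why it might fail: no divisibility toward X_Gr is in print for `f̃` multiplicative Eisenstein on the `χ_ε`-branch; KY24's Hida argument (Thm. 5.1.3, `p ‖ N`) may not survive the twist (specialisation at 𝟙 off the family; `μ` at `p = 3`).
sources: arXiv:2402.12781, arXiv:2410.23241, arXiv:1511.08172, arXiv:2303.04373
[crux] on the potentially MULTIPLICATIVE reducible cell (M) with `r_an = 1`: for every
Heegner/parametrisation datum and every anticyclotomic frame `(κ, γ, 𝔭)` with `𝔭 ∣ p` of degree one,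
a generator `f` of `char_Λ X_Gr(E/K_∞^{ac})` (strict at `𝔭`, relaxed at `𝔭̄`, tree `XAc … ∅`) has
`2·ord_p log_ω P ≤ ord_p f(0) + 2·v_p(c)` — the door direction `𝓛^{BDP} ∣ char` at 𝟙 composed with
LZZ18 Thm. 1.8 (intrinsic in `ω_f`; `log_{ω_E} = c·log_{ω_f}`): T-B6-1♯ Manin-robust,
`AdditiveIMCLowerBDPInputManinAt` on SubM. [difficulty: open-problem] -/
@[route_item "route-BirchSwinnertonDyer-SchneiderFreeAdditiveX3", crux]
def PotMultBranchIMC : Prop :=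
  ∀ (W : WeierstrassCurve ℚ) [W.IsElliptic] [W.IsGloballyMinimal] (p : ℕ) [Fact p.Prime], W.analyticRank = 1 → p ≠ 2 → Literature.NumberTheory.EllipticCurves.Rank1Residual.ClassX3 W p → Summit.BirchSwinnertonDyer.Rank1Residual.Additive.SubM W p → Summit.BirchSwinnertonDyer.BirchSwinnertonDyer.Theorems.SchneiderFree.AdditiveIMCLowerBDPInputManinAt W p

/-- item stmt-BirchSwinnertonDyer-19177 · crux · rank 3 · open · by planner
why it might fail: two preprint layers (KY24b resting on KY24 and on an in-proof generalisation of JLZ21's Heegner cycles); CGLS §3's `p ∤ 6N` at `p = 3` (2 411 of the 2 560 pairs); lattice/isogeny choice `φ|_{G_p} ≠ 𝟙`.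
sources: arXiv:2410.23241, arXiv:2402.12781, arXiv:1505.08165, arXiv:1511.08172
[crux] the same on the potentially GOOD ordinary `e = 2` reducible cell: Keller–Yin 2410.23241 Thm.
3.5.1 (`Char_Λ(𝔛)Λ^{ur} = (𝓛_ε)` for the Heegner pair `(f̃, χ_ε)`, `p > 2`, `p ∤ N′`, `p` split) ∘
LZZ18 Thm. 1.8 at 𝟙 ∘ interpolation matching of `𝓛_ε` (CH18's measure for `f̃` shifted by `χ_ε`)
with LZZ's distribution — T-B6-1♯ Manin-robust on SubGordTwo (slack `2·v_p(c)`, no `p ∤ c`).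
[difficulty: XL] -/
@[route_item "route-BirchSwinnertonDyer-SchneiderFreeAdditiveX3", crux]
def GordTwoBranchIMC : Prop :=
  ∀ (W : WeierstrassCurve ℚ) [W.IsElliptic] [W.IsGloballyMinimal] (p : ℕ) [Fact p.Prime], W.analyticRank = 1 → p ≠ 2 → Literature.NumberTheory.EllipticCurves.Rank1Residual.ClassX3 W p → Summit.BirchSwinnertonDyer.Rank1Residual.Additive.SubGordTwo W p → Summit.BirchSwinnertonDyer.BirchSwinnertonDyer.Theorems.SchneiderFree.AdditiveIMCLowerBDPInputManinAt W p

/-- item stmt-BirchSwinnertonDyer-19180 · crux · rank 9 · closed · proved by Summit.BirchSwinnertonDyer.BirchSwinnertonDyer.Theorems.schneiderFreeAdditiveX3_jointLowerManin_proof (prover) · by planner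
why it might fail: at `p = 3` (95 % of the cells) the K-to-ℚ transfer meets rational 3-torsion (X3: torsion inside `[E(K):ℤP]`, `u_K`); the c-robust re-proof of `X11b.exists_shaAn_padicVal_eq_of_heegner` must yield BOTH rationals `#Ш_an(E)`, `#Ш_an(E^{d_K})` with no datum `q_d`.
sources: GrossZagier1986, arXiv:1512.06894, Miller2011LMS, arXiv:1911.09446
[crux] Gross–Zagier bookkeeping at an ADDITIVE prime, Manin-robust (tree leaf
`SchneiderFree.JointLowerOfStepLManin`, closed, conjecture-tagged), FROM seven printed facts carried
as EXPLICIT antecedents (Gross–Zagier I.(6.3) `gross_zagier`, Kolyvagin `kolyvagin`, GZK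
`rank_eq_analyticRank_of_analyticRank_le_one`, modularity `hasEntireLFunction_rat`, a
parametrisation datum `nonempty_modularParametrizationData`, Cassels `bsdRHS_eq_of_isIsogenous`, and
Gross–Zagier I.(7.3) `GrossZagier1986_thm_I_7_3` for the rationality of `#Ш_an(E)` in rank one — the
partner's `#Ш_an(E^{d_K}) ∈ ℚ` then follows from the product identity): STEP L over `K` at slack
`2·v_p(c)` + GZ86 I.(6.3) WITH the constant kept (`#Ш_an(E)·#Ш_an(E^{d_K})·∏c·∏c ≐ ([E(K):ℤP]/c)²`;
`gross_zagier` carries `Dt.c ^ 2`) + `L(E/K,s) = L(E,s)L(E^{d_K},s)` + `Ш(E/K)[p^∞] ≅ Ш(E)[p^∞] ⊕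
Ш(E^{d_K})[p^∞]` (odd `p`) + (eq:tamK) and `v_p(u) = 0` for the twist's minimal model (TREE:
`X2.padicValNat_tamagawaProduct_twist_of_heegner_of_odd`,
`X11b.padicValRat_u_eq_zero_of_twist_minimal_of_splitsIn`, no reduction-type hypothesis) ⟹ the JOINT
lower half `JointLowerBoundAt W Wd p`; the `2·v_p(c)` cancel, so NO Manin hypothesis (FINDING cac -/
@[route_item "route-BirchSwinnertonDyer-SchneiderFreeAdditiveX3", crux]
def JointLowerManin : Prop :=
  (∀ (N : ℕ) [NeZero N] (W : WeierstrassCurve ℚ) (K : Type) [Field K] [NumberField K], Literature.NumberTheory.EllipticCurves.gross_zagier N W K) → (∀ (N : ℕ) [NeZero N] (W : WeierstrassCurve ℚ) (K : Type) [Field K] [NumberField K], Literature.NumberTheory.EllipticCurves.kolyvagin N W K) → Literature.NumberTheory.EllipticCurves.rank_eq_analyticRank_of_analyticRank_le_one → WeierstrassCurve.hasEntireLFunction_rat → Literature.NumberTheory.EllipticCurves.ModularForms.nonempty_modularParametrizationData → WeierstrassCurve.bsdRHS_eq_of_isIsogenous → Literature.NumberTheory.EllipticCurves.GrossZagier1986_thm_I_7_3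 → Summit.BirchSwinnertonDyer.BirchSwinnertonDyer.Theorems.SchneiderFree.JointLowerOfStepLManin

-- `JointLowerManin` holds: proved by `Summit.BirchSwinnertonDyer.BirchSwinnertonDyer.Theorems.schneiderFreeAdditiveX3_jointLowerManin_proof` (its module imports this route file, so no `_holds` link can be stated here).

/-- item stmt-BirchSwinnertonDyer-19393 · aside · rank 0 · open · by planner
[target] STEP L, MANIN-ROBUST — KOLYVAGIN-PREFIXED re-typing of the rev-3 target StepLManin (19175):
`(∀ N W K, kolyvagin N W K) → ∀ W p, r_an = 1 → p ≠ 2 → ClassX3 W p → SubSemistableTwist W p →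
SchneiderFree.AdditiveStepLInputManinAt W p` (the JSW17 (eq:shalowerK-1) inequality with the
parametrisation constant as slack, for every pair on the B6 cells and every Heegner datum). WHY
(F2-class, same defect as 19178/19179 repaired in rev 4–6): the fact-free 19175 follows from the
three cruxes only THROUGH the cite-only Kolyvagin fact (rank E(K) = 1, Ш(E/K) finite — consumed by
the control equality), so as typed it can never close in-tree even after 19176/19177/19295 close;
this item closes by the 3-line proof `fun hKo => StepLManinLinkR_proof hKo h₂ h₃ (h₄ hKo)` from the
landed 19263 once the cruxes land. `closes` is unchanged (it derives Step L inline); 19175 → aside +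
held. Filed by the route base unit P2 g8. sources: JetchevSkinnerWan2017 §7.4.1, Gross1991 Thm 1.3,
Kolyvagin1990 -/
@[route_item "route-BirchSwinnertonDyer-SchneiderFreeAdditiveX3"]
def StepLManinK : Prop :=
  (∀ (N : ℕ) [NeZero N] (W : WeierstrassCurve ℚ) (K : Type) [Field K] [NumberField K], Literature.NumberTheory.EllipticCurves.kolyvagin N W K) → ∀ (W : WeierstrassCurve ℚ) [W.IsElliptic] [W.IsGloballyMinimal] (p : ℕ) [Fact p.Prime], W.analyticRank = 1 → p ≠ 2 → Literature.NumberTheory.EllipticCurves.Rank1Residual.ClassX3 W p → Summit.BirchSwinnertonDyer.Rank1Residual.Additive.SubSemistableTwist W p → Summit.BirchSwinnertonDyer.BirchSwinnertonDyer.Theorems.SchneiderFree.AdditiveStepLInputManinAt W p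

/-- item stmt-BirchSwinnertonDyer-19178 · support · rank 4 · open · by planner
why it might fail: on 57.9 % of B6's pairs (all of `(p,e) = (3,2)` with `E(ℚ_3)[3] ≠ 0`, III@5, II@7; kit j243439) the strict-place fixed points are non-zero and the `v̄`-convention shift `#H⁰(K_v̄,W) = p` must be re-derived by hand; Fin_v at `𝔭`.
sources: arXiv:1512.06894, arXiv:1408.4044
[crux] anticyclotomic control with EQUALITY at an additive prime split in `K`: `ord_p f(0) = ord_p
#Ш(E/K)[p^∞] + 2(ord_p log_ω P − ord_p[E(K):ℤP]) + ord_p ∏_{w∣N⁺} c_w(E/K)` at every frame (Euler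
shift `0` since `a_p = 0`; the local `p`-torsion exponent `t_p` cancels) — T-B6-2′♯ without the
(unused) `p ∤ c` hypothesis, `AdditiveControlInputManinAt`; JSW17 Prop. 6 / Thm. 8 re-derived off
their Case 3(b); kernel-reduced to the X11b atoms when `E(ℚ_p)[p] = 0`
(`additiveControlOnTreeAt_of_atoms`, the BC5 rung). [difficulty: L] -/
@[route_item "route-BirchSwinnertonDyer-SchneiderFreeAdditiveX3", crux]
def AnticycControlAdditive : Prop :=
  ∀ (W : WeierstrassCurve ℚ) [W.IsElliptic] [W.IsGloballyMinimal] (p : ℕ) [Fact p.Prime], W.analyticRank = 1 → p ≠ 2 → Literature.NumberTheory.EllipticCurves.Rank1Residual.ClassX3 W p → Summit.BirchSwinnertonDyer.Rank1Residual.Additive.SubSemistableTwist W p → Summit.BirchSwinnertonDyer.BirchSwinnertonDyer.Theorems.SchneiderFree.AdditiveControlInputManinAt W p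

/-- item stmt-BirchSwinnertonDyer-19295 · support (kind.auto-crux: conjecture-grade) · rank 4 · open · by planner
why it might fail: auto-crux — conjecture-grade (statement references the registered conjecture Summit.BirchSwinnertonDyer.BirchSwinnertonDyer.Theorems.SchneiderFree.Add): the deciding theorem assumes it and nothing in the route derives it, so it is a bet, not glue
sources: closes-admissibility
[crux] repaired `AnticycControlAdditive` (F2-class re-typing, P2 g8 2026-08-26): the SAME
anticyclotomic control EQUALITY at an additive prime split in `K` (`X_ac` Λ-torsion, `f_ac(0) ≠ 0`,
`ord_p f_ac(0) = ord_p #Ш(E/K)[p^∞] + 2(ord_p log_ω P − ord_p[E(K):ℤP]) + ord_p ∏_{w∣N⁺} c_w(E/K)`,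
Euler shift 0, `t_p` cancels), now stated UNDER Kolyvagin's theorem as an explicit printed-fact
antecedent `(∀ N W K, kolyvagin N W K) →` (the conjunct `closes` already destructures from
`PrintedFacts`). Reason: JSW17 §3's standing hypotheses (corank 1) + (sur) are rank E(K) = 1 ∧
#Ш(E/K)[p^∞] < ∞, which follow in the tree from the Heegner point's non-torsion ONLY through the
cite-only fact `kolyvagin`; without the antecedent the fact-free item 19178 is unprovable in-tree as
typed (same defect as door-c2 FINDING F2 on `StepLManinLink`). Mordell–Weil is a tree theorem
(`WeierstrassCurve.module_finite_point_holds`), so no further global antecedent is needed; local /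
cohomological inputs stay behind the X11b / SchneiderFreeControlAtoms sockets (BC5 rung
`additiveControlOnTreeAt_of_atoms`). The old decl implies this one by `fun h _ => h`; door-c4's
registered stubs carry over with the same prefix. why -/
@[route_item "route-BirchSwinnertonDyer-SchneiderFreeAdditiveX3", crux]
def AnticycControlAdditiveK : Prop :=
  (∀ (N : ℕ) [NeZero N] (W : WeierstrassCurve ℚ) (K : Type) [Field K] [NumberField K], Literature.NumberTheory.EllipticCurves.kolyvagin N W K) → ∀ (W : WeierstrassCurve ℚ) [W.IsElliptic] [W.IsGloballyMinimal] (p : ℕ) [Fact p.Prime], W.analyticRank = 1 → p ≠ 2 → Literature.NumberTheory.EllipticCurves.Rank1Residual.ClassX3 W p → Summit.BirchSwinnertonDyer.Rank1Residual.Additive.SubSemistableTwist W p → Summit.BirchSwinnertonDyer.BirchSwinnertonDyer.Theorems.SchneiderFree.AdditiveControlInputManinAt W p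

/-- item stmt-BirchSwinnertonDyer-19548 · support · rank 4 · open · by planner
why it might fail: Only via its two open stubs: Fin_v at the (3, e=2) local-3-torsion frames (the local anticyclotomic line could a priori be the weight-1 line of V_3E, making #ker r_𝔭 < #E(ℚ_3)[3^∞]) and the B2 count at 3-torsion members (extra 3^g defects); one miscounted B6 pair refutes the typed equality.
sources: p447721, p448348, MazurRubin2004, Greenberg1999
[crux] the SERVED control corner, F2-class re-typing #2 (rank 4; P2 g9 rev 9; supersedes
`AnticycControlAdditiveK` = stmt-BirchSwinnertonDyer-19295 in `closes`, which becomes support): the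
SAME pointwise anticyclotomic control input `SchneiderFree.AdditiveControlInputManinAt W p` on every
W in B6 ∩ X3 ∩ sst-twist with r_an = 1, p odd, now stated under the four cite-only PT/CFT facts of
`ControlFacts` AND Kolyvagin as explicit antecedents — door-c4 g2 showed every closing proof of the
corner consumes `poitouTate_selmerStructure_duality`, `poitouTate_sha_tateDual`, Brink Thm 2 / Cor 1
(cite-only `def`s), so the Kolyvagin-only item 19295 is unprovable in-tree as typed (same defect
class as 19178 → 19295 at rev 6). `closes` feeds it `hCF`'s conjuncts and `hKo`; `h4 hPT hSha hBr
hBrA` is definitionally 19295's statement, so `StepLManinLinkR` is reused verbatim. Skeleton v4-KF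
(registered with this item): stubs = the items `ControlNoLocalPTorsionF` (regime A, closes now),
`ControlNoGlobalPTorsionF` (regime B1, closes on RegimeB1.lean), `LocalTowerTorsionFiniteX3`
(Fin_v), `ControlGlobalPTorsionF` (regime B2); composition = the local/global torsion trichotomy
(kernel-checked, rev9/RouteCt -/
@[route_item "route-BirchSwinnertonDyer-SchneiderFreeAdditiveX3", crux]
def AnticycControlAdditiveKF : Prop :=
  (∀ (K : Type) [Field K] [NumberField K], Literature.NumberTheory.GaloisCohomology.poitouTate_selmerStructure_duality K) → (∀ (K : Type) [Field K] [NumberField K], Literature.NumberTheory.GaloisCohomology.poitouTate_sha_tateDual K) → (∀ (K : Type) [Field K] [NumberField K] (p : ℕ) [Fact p.Prime], Literature.NumberTheory.EllipticCurves.ZpExtension.decomp_not_le_kerSubgroup_of_isAnticyclotomic K p) → (∀ (K : Type) [Field K] [NumberField K] (p : ℕ) [Fact p.Prime], Literature.NumberTheory.EllipticCurves.ZpExtension.decomp_not_le_kerSubgroup_above_of_isAnticyclotomic K p) → (∀ (N : ℕ) [NeZero N] (W : WeierstrassCurve ℚ) (K : Type) [Field K] [NumberField K], Literature.NumberTheory.EllipticCurves.kolyvagin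 N W K) → ∀ (W : WeierstrassCurve ℚ) [W.IsElliptic] [W.IsGloballyMinimal] (p : ℕ) [Fact p.Prime], W.analyticRank = 1 → p ≠ 2 → Literature.NumberTheory.EllipticCurves.Rank1Residual.ClassX3 W p → Summit.BirchSwinnertonDyer.Rank1Residual.Additive.SubSemistableTwist W p → Summit.BirchSwinnertonDyer.BirchSwinnertonDyer.Theorems.SchneiderFree.AdditiveControlInputManinAt W p

/-- item stmt-BirchSwinnertonDyer-19546 · support · rank 5 · open · by planner
why it might fail: Case a = 1 of the parity argument needs the local anticyclotomic character at a split 3 to be locally algebraic with Frobenius eigenvalue of absolute value 1 (ring-class CFT, only sketched, memo L45); if the local tower at 𝔭 were the β-line of V_3E, E(K_∞,w)[3^∞] is infinite and #ker r_𝔭 < 3^{t_p}.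
sources: p440899, p446206, p447721, JSW2017
[crux] Fin_v on the door's cells (rank 5; P2 g9 rev 9): for every W in B6 ∩ X3 ∩ sst-twist with r_an
= 1 and odd p, `LocalTowerTorsionFiniteClaim W p` — at every imaginary quadratic K with p split,
every anticyclotomic ℤ_p-extension κ and every 𝔭 ∣ p, the p-primary torsion of E over the completed
tower K_{∞,w} (= `E(K̄)[p^∞]^{D_𝔭 ⊓ ker κ}`) is FINITE. This is JSW17 Prop 3.3.4 Case 3(b)'s input
`T^∨_{P_v}` finite, which JSW derive from (sst)+(HT); here p is ADDITIVE (pot. good ordinary or pot.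
multiplicative, e = 2). A TREE THEOREM wherever `E(ℚ_p)[p] = 0`
(`localTowerTorsionFiniteAt_of_noPTorsion`), so the OPEN content is exactly the (3, e = 2) frames
with local 3-torsion (t_p = 1: 57.9 % of the door's optimal curves, all at p = 3 — door-c4 g2
census; the t_p = 0 half is 42.1 %). Intended proof (memo ROUTE-P2 L45, OUR DERIVATION, not in print
as stated): an infinite `E[p^∞]^{G_{K_∞,w}}` gives a sub-character β of V_pE|G_{ℚ_p} factoring
through the local image of Γ^ac; β is Hodge–Tate of weight a ∈ {0,1}; a = 0 ⇒ β potentially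
unramified of finite order ⇒ infinite torsion over a finite extension of ℚ_p (Mattuck) — absurd; a =
1 ⇒ β = χ_cyc·unr(p/α) (α the unit root of E♭ = E ⊗ χ_{p* -/
@[route_item "route-BirchSwinnertonDyer-SchneiderFreeAdditiveX3", crux]
def LocalTowerTorsionFiniteX3 : Prop :=
  ∀ (W : WeierstrassCurve ℚ) [W.IsElliptic] [W.IsGloballyMinimal] (p : ℕ) [Fact p.Prime], W.analyticRank = 1 → p ≠ 2 → Literature.NumberTheory.EllipticCurves.Rank1Residual.ClassX3 W p → Summit.BirchSwinnertonDyer.Rank1Residual.Additive.SubSemistableTwist W p → (∀ (K : Type) [Field K] [NumberField K], Literature.NumberTheory.EllipticCurves.IsImaginaryQuadratic K → Summit.BirchSwinnertonDyer.Rank1Residual.X11b.SplitsIn K p → ∀ (κ : Literature.NumberTheory.EllipticCurves.ZpExtension K p), κ.IsAnticyclotomic → ∀ (𝔭 : IsDedekindDomain.HeightOneSpectrum (NumberField.RingOfIntegers K)), ((p : ℕ) : NumberField.RingOfIntegers K) ∈ 𝔭.asIdeal → (FixedPoints.addSubgroup ↥(Literature.NumberTheory.EllipticCurves.GreenbergSelmer.decomp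 𝔭 ⊓ κ.kerSubgroup) ((W.baseChange K).geomPrimaryTorsion p) : Set ((W.baseChange K).geomPrimaryTorsion p)).Finite)

/-- item stmt-BirchSwinnertonDyer-19668 · support · rank 5 · closed · proved by Summit.BirchSwinnertonDyer.BirchSwinnertonDyer.Theorems.SchneiderFreeAdditiveX3.localTowerTorsionFiniteX3F_proof (prover) · by planner
sources: p443291, p451736, p452324, JSW2017
[support] F-typed RECORD of Fin_v (P2 g11, rev 14; F2-class rule, RECIPE-FinV-F2 (i)): the cite-only
local-class-field-theory fact `ZpExtension.exists_isFrobPow_mem_kerSubgroup_of_isAnticyclotomic`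
(door-c5 g5 p443291: Cassels–Fröhlich VII §6, Serre LCFT §2.5/§3.1, Brink 2007 §II Prop. 1/Cor. 1)
as the ONE explicit antecedent → `LocalTowerTorsionFiniteX3` (item 19546 verbatim, by name). Tate
uniformisation A41 is PROVED in the tree
(`Literature.NumberTheory.EllipticCurves.TateCurve.Silverman1994_thmV53_corV54_tateUniformisation_holds`)
and is discharged by the closer, not carried. The (M) half is landed (door-c2 g5 p451736
`lineCharacter_subM` / `stub_finV_potMult_of_facts`, p452324
`localTowerTorsionFiniteX3_of_facts_of_stub_gordTwo`); the item closes BY NAME by `fun h ↦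
localTowerTorsionFiniteX3_of_facts_of_stub_gordTwo h
Silverman1994_thmV53_corV54_tateUniformisation_holds (stub_finV_gordTwo_of_CFT h)` the hour the
(G-ord, e = 2) «canonical line with character at (K,𝔭)» lands (door-c5 g6 / door-c4 g5 / door-c6 g3
in flight; closer shape kernel-checked in the planner folder rev12/FRecordCheck.lean, rc 0). A
RECORD, off the leaf's critical path (p447721): closing it makes the exac -/
@[route_item "route-BirchSwinnertonDyer-SchneiderFreeAdditiveX3"]
def LocalTowerTorsionFiniteX3F : Prop :=
  (∀ (K : Type) [Field K] [NumberField K] (p : ℕ) [Fact p.Prime], Literature.NumberTheory.EllipticCurves.ZpExtension.exists_isFrobPow_mem_kerSubgroup_of_isAnticyclotomic K p) → LocalTowerTorsionFiniteX3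

-- `LocalTowerTorsionFiniteX3F` holds: proved by `Summit.BirchSwinnertonDyer.BirchSwinnertonDyer.Theorems.SchneiderFreeAdditiveX3.localTowerTorsionFiniteX3F_proof` (its module imports this route file, so no `_holds` link can be stated here).

/-- item stmt-BirchSwinnertonDyer-19669 · support · rank 5 · closed · proved by Summit.BirchSwinnertonDyer.BirchSwinnertonDyer.Theorems.SchneiderFreeAdditiveX3.anticycControlAdditiveKFF_proof (prover) · by planner
sources: p442095, p443572, p447721, JSW2017, Greenberg1999
[support] F-typed RECORD of the control corner's exact count (P2 g11, rev 14; F2-class rule): the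
same cite-only LCFT fact (p443291) as the one explicit antecedent → `AnticycControlAdditiveKF` (item
19548 verbatim, by name: the anticyclotomic control EQUALITY #Sel = #(Λ/f_ac^Σ)_Γ · (torsion atoms)
under PT ×2 / Brink ×2 / Kolyvagin). Closes BY NAME by the one-liner `fun h ↦
Theorems.SchneiderFreeAdditiveX3.anticycControlAdditiveKF_of_finV_of_regimeB2
(‹LocalTowerTorsionFiniteX3F› h) Theorems.SchneiderFreeAdditiveX3.controlGlobalPTorsionF_holds`
(door-c4 g3 p442095 + p443572; regimes A / B1 closed p437517 / p437649) as soon as the Fin_v record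
`LocalTowerTorsionFiniteX3F` closes (closer kernel-checked in the planner folder
rev12/FRecordCheck.lean, rc 0). A RECORD, off the leaf's critical path since p447721/p448348 (the
leaf uses only the inequality). why it might fail: it cannot fail beyond its antecedent Fin_v
record; if the (G-ord) hLine needs a further cite-only fact, re-type both records with it. sources:
p442095, p443572, p447721; JSW2017 (arXiv:1512.06894) Prop. 3.3.1/Thm. 3.3.3; Greenberg1999 (LNM
1716). -/
@[route_item "route-BirchSwinnertonDyer-SchneiderFreeAdditiveX3"]
def AnticycControlAdditiveKFF : Prop :=
  (∀ (K : Type) [Field K] [NumberField K] (p : ℕ) [Fact p.Prime], Literature.NumberTheory.EllipticCurves.ZpExtension.exists_isFrobPow_mem_kerSubgroup_of_isAnticyclotomic K p) → AnticycControlAdditiveKF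

-- `AnticycControlAdditiveKFF` holds: proved by `Summit.BirchSwinnertonDyer.BirchSwinnertonDyer.Theorems.SchneiderFreeAdditiveX3.anticycControlAdditiveKFF_proof` (its module imports this route file, so no `_holds` link can be stated here).

/-- item stmt-BirchSwinnertonDyer-19547 · banked · rank 6 · closed · proved by Summit.BirchSwinnertonDyer.BirchSwinnertonDyer.Theorems.SchneiderFreeAdditiveX3.stub_regimeB2 (prover) · by planner
why it might fail: With E(K)[3] ≠ 0 the restriction to K_∞ has kernel 3^g and the level-N lifting must hit classes modulo an extra E(K)[3]/3^N-defect; if the defects at 𝔭 and globally do not cancel as KY 2402.12781 Thm 7.0.6 asserts at semistable p, the count is off by 3^g (no print at additive Eisenstein 3).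
sources: arXiv:2402.12781, arXiv:1512.06894, REFEREE-g20-adjudication.md (evidence on stmt-BirchSwinnertonDyer-19178), CONTROL-DERIVATION.md v3 §7 (door-c4), CONTROL-tp-P2-g8.md
[crux] regime B2 of the control corner (rank 6; P2 g9 rev 9): the control equality
`AdditiveControlOnTreeAt` at the frames WITH GLOBAL p-TORSION (`E(K)[p] ≠ 0`, i.e. ¬ ∀ x : E(K), p•x
= 0 → x = 0): p = 3, the 3-torsion members of 64.4 % of the p = 3 X3 isogeny classes of the door
(kit j248537; every class also has an E(K)[3] = 0 member), GIVEN Fin_v on the cell and under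
`ControlFacts` + Kolyvagin. The typed equality is EXACT uniformly in (g, t_p) (referee g20: KY
2402.12781 Thm 7.0.6, count with /(#H⁰(K,E[p^∞]))²; door-c4 g1 torsion-robust count p419833
`natCard_endInvariants_mul_natCard_resKer_eq`), so this is door-c4/door-c6's any-torsion versions of
the two Poitou–Tate stubs (P9 `stub_ptSurj`, L10 `stub_coinv` with g ≥ 1: the global surgery must
control `E(K)[p]` inside the level-N Selmer groups) + the base count with exponent `+g`.
Alternative: isogeny transport of the LEAF (not of control) to the E(K)[3] = 0 member via Cassels
(`bsdRHS_eq_of_isIsogenous` ∈ PrintedFacts) — would need 'every class has a regime-A/B1 member' as a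
theorem. why it might fail: with E(K)[3] ≠ 0 the restriction H¹(K,E[3^∞]) → H¹(K_∞,E[3^∞]) has
kernel of order 3^g and the level-N lifting (P9⁺) must hi -/
@[route_item "route-BirchSwinnertonDyer-SchneiderFreeAdditiveX3", crux]
def ControlGlobalPTorsionF : Prop :=
  (∀ (K : Type) [Field K] [NumberField K], Literature.NumberTheory.GaloisCohomology.poitouTate_selmerStructure_duality K) → (∀ (K : Type) [Field K] [NumberField K], Literature.NumberTheory.GaloisCohomology.poitouTate_sha_tateDual K) → (∀ (K : Type) [Field K] [NumberField K] (p : ℕ) [Fact p.Prime], Literature.NumberTheory.EllipticCurves.ZpExtension.decomp_not_le_kerSubgroup_of_isAnticyclotomic K p) → (∀ (K : Type) [Field K] [NumberField K] (p : ℕ) [Fact p.Prime], Literature.NumberTheory.EllipticCurves.ZpExtension.decomp_not_le_kerSubgroup_above_of_isAnticyclotomic K p) → (∀ (N : ℕ) [NeZero N] (W : WeierstrassCurve ℚ) (K : Type) [Field K] [NumberField K], Literature.NumberTheory.EllipticCurves.kolyvagin N W K) → ∀ (W : WeierstrassCurve ℚ) [W.IsElliptic] [W.IsGloballyMinimal]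 (p : ℕ) [Fact p.Prime], W.analyticRank = 1 → p ≠ 2 → Literature.NumberTheory.EllipticCurves.Rank1Residual.ClassX3 W p → Summit.BirchSwinnertonDyer.Rank1Residual.Additive.SubSemistableTwist W p → (∀ (K : Type) [Field K] [NumberField K], Literature.NumberTheory.EllipticCurves.IsImaginaryQuadratic K → Summit.BirchSwinnertonDyer.Rank1Residual.X11b.SplitsIn K p → ∀ (κ : Literature.NumberTheory.EllipticCurves.ZpExtension K p), κ.IsAnticyclotomic → ∀ (𝔭 : IsDedekindDomain.HeightOneSpectrum (NumberField.RingOfIntegers K)), ((p : ℕ) : NumberField.RingOfIntegers K) ∈ 𝔭.asIdeal → (FixedPoints.addSubgroup ↥(Literature.NumberTheory.EllipticCurves.GreenbergSelmer.decomp 𝔭 ⊓ κ.kerSubgroup) ((W.baseChange K).geomPrimaryTorsion p) : Set ((W.baseChange K).geomPrimaryTorsion p)).Finite) → ∀ (N : ℕ) [NeZero N] (K : Type) [Field K] [NumberField K] (Dt : Literature.NumberTheory.EllipticCurves.ModularForms.ModularParametrizationData W N) (H : Literature.NumberTheory.EllipticCurves.HeegnerDatum N (NumberField.discr K)) (ι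 : K →+* ℂ) (P : (W.baseChange K).toAffine.Point), W.analyticRank = 1 → Summit.BirchSwinnertonDyer.Rank1Residual.Additive.N10.Locus W p → WeierstrassCurve.conductorNorm ℤ W = N → Literature.NumberTheory.EllipticCurves.IsImaginaryQuadratic K → Odd (NumberField.discr K) → ¬ p ∣ NumberField.Units.torsionOrder K → Literature.NumberTheory.EllipticCurves.SatisfiesHeegnerHypothesis N K → (W.quadraticTwist (NumberField.discr K : ℚ)).entireLFunction 1 ≠ 0 → (WeierstrassCurve.Affine.Point.map ι.toRatAlgHom) P = Literature.NumberTheory.EllipticCurves.ModularForms.heegnerPointComplex Dt H → ¬ IsOfFinAddOrder P → ∀ (κ : Literature.NumberTheory.EllipticCurves.ZpExtension K p), κ.IsAnticyclotomic → ∀ (γ : Field.absoluteGaloisGroup K) [Fact (κ.IsTopGenerator γ)] (𝔭 : IsDedekindDomain.HeightOneSpectrum (NumberField.RingOfIntegers K)) (h𝔭 : ((p : ℕ) : NumberField.RingOfIntegers K) ∈ 𝔭.asIdeal) (he : 𝔭.asIdeal.ramificationIdx (NumberField.RingOfIntegers ℚ) = 1) (hf : 𝔭.asIdeal.inertiaDeg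 (NumberField.RingOfIntegers ℚ) = 1), ¬ (∀ x : (W.baseChange K).toAffine.Point, p • x = 0 → x = 0) → Summit.BirchSwinnertonDyer.BirchSwinnertonDyer.Theorems.SchneiderFree.AdditiveControlOnTreeAt p κ 𝔭 γ (Summit.BirchSwinnertonDyer.Rank1Residual.X11b.embAt K p 𝔭 h𝔭 he hf) P

-- `ControlGlobalPTorsionF` holds: proved by `Summit.BirchSwinnertonDyer.BirchSwinnertonDyer.Theorems.SchneiderFreeAdditiveX3.stub_regimeB2` (its module imports this route file, so no `_holds` link can be stated here).

/-- item stmt-BirchSwinnertonDyer-19179 · support · rank 9 · open · by planner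
sources: arXiv:1512.06894
[support] the three cruxes give `StepLManin`: pointwise the PROVED bookkeeping
`index_le_slack_of_additive_links` (slack-`s` T-B6-1 ∧ T-B6-2′ ⟹ JSW (eq:shalowerK-1) + `2s`,
sockets v2), plus frame plumbing (an anticyclotomic ℤ_p-extension with topological generator, a
degree-one `𝔭 ∣ p`, `#Ш(E/K)[p^∞]` vs `ord_p #Ш(E/K)`, `∏_w c_w(E/K) = (∏_ℓ c_ℓ)²` for an all-split
`K`). [difficulty: M] -/
@[route_item "route-BirchSwinnertonDyer-SchneiderFreeAdditiveX3"]
def StepLManinLink : Prop :=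
  PotMultBranchIMC → GordTwoBranchIMC → AnticycControlAdditive → StepLManin

/-- item stmt-BirchSwinnertonDyer-19181 · support · rank 9 · closed · proved by Summit.BirchSwinnertonDyer.BirchSwinnertonDyer.Theorems.schneiderFreeAdditiveX3_partnerUpperRankZero_proof (prover) · by planner
sources: Delbourgo1998, Wuthrich2014, Miller2011LMS
[support] the UPPER half on the rank-ZERO semistable-twist X3 rows, every odd `p`, FROM its six
printed facts as explicit antecedents (Delbourgo 1998 Prop. 4, GZK, modularity, a parametrisation
datum, Wuthrich 2014 Thm. 16 half and component) — VERBATIM the TREE theorem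
`SchneiderFree.partnerUpperX3RankZero_of_facts` (re-keying
`Additive.ClassX3.missingUpperBoundAt_rankZero_of_subSemistableTwist`; kernel-checked as
`partnerUpperRankZero_holds` in `RenderSimV16.lean`). [difficulty: provable-now] -/
@[route_item "route-BirchSwinnertonDyer-SchneiderFreeAdditiveX3", crux]
def PartnerUpperRankZero : Prop :=
  Literature.NumberTheory.EllipticCurves.Delbourgo1998.prop4_rankZero_pow_dvd_constantCoeff → Literature.NumberTheory.EllipticCurves.rank_eq_analyticRank_of_analyticRank_le_one → WeierstrassCurve.hasEntireLFunction_rat → Literature.NumberTheory.EllipticCurves.ModularForms.nonempty_modularParametrizationData → Literature.NumberTheory.EllipticCurves.Wuthrich2014.thm16_halfEigenCharIdeal_dvd_cyclotomicPrime → Literature.NumberTheory.EllipticCurves.Wuthrich2014.charIdeal_dvd_padicLFunctionBranch_component → ∀ (Wd : WeierstrassCurve ℚ) [Wd.IsElliptic] [Wd.IsGloballyMinimal] (p : ℕ) [Fact p.Prime], Wd.analyticRank = 0 → p ≠ 2 → Literature.NumberTheory.EllipticCurves.Rank1Residual.ClassX3 Wd p → Summit.BirchSwinnertonDyer.Rank1Residual.Additive.SubSemistableTwist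 Wd p → Literature.NumberTheory.EllipticCurves.Rank1Residual.Typed.MissingUpperBoundAt Wd p

-- `PartnerUpperRankZero` holds: proved by `Summit.BirchSwinnertonDyer.BirchSwinnertonDyer.Theorems.schneiderFreeAdditiveX3_partnerUpperRankZero_proof` (its module imports this route file, so no `_holds` link can be stated here).

/-- item stmt-BirchSwinnertonDyer-19183 · support · rank 9 · closed · proved by Summit.BirchSwinnertonDyer.BirchSwinnertonDyer.Theorems.schneiderFreeAdditiveX3_heegnerTwistData_proof (prover) · by planner
sources: FriedbergHoffstein1995, GrossZagier1986, arXiv:1512.06894, BumpFriedbergHoffstein1990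
[support] (tree predicate `SchneiderFree.HeegnerTwistDataManinAt W p`, the rev-0 data WITHOUT `p ∤
c`) FROM six printed facts carried as explicit antecedents — Friedberg–Hoffstein Thm. B with
prescribed splitting (`friedbergHoffstein_exists_heegnerField_splitDivisors_twist_ne_zero`, TREE
named fact, used with `M = 2p`: `2` and `p` split, so `d_K ≡ 1 (mod 8)` is odd and `|d_K| > 4` gives
`#𝓞_K^× = 2`), the parity fact `even_analyticRank_iff_rootNumber_eq_one` (`r_an = 1 ⟹ w = −1`),
Heegner points over `K` (`exists_isHeegnerPoint`), Gross–Zagier (`gross_zagier`: `P` non-torsion ⟺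
`L′(E/K,1) ≠ 0`), modularity (`hasEntireLFunction_rat`: `L(E/K) = L(E)L(E^{d_K})`, `r_an(E^{d_K}) =
0`) and a parametrisation datum: for a pair on the cells there exist a Heegner field `K` for `N_E`
(odd `d_K`, `p ∤ #𝓞_K^×`, `p` split) with `L(E^{d_K},1) ≠ 0`, a parametrisation datum, its traced
Heegner point (non-torsion), and a globally minimal model `Wd` of the twist
(`exists_isGloballyMinimal_smul_eq_quadraticTwist`, tree theorem) on the same cells with `r_an(Wd) =
0` (`d_K ∈ (ℚ_p^×)²`: `j`, `v_p(Δ_min)`, reduction type and `E[p]`-reducibility are twist-invariant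
— elementary, to be proved). [difficulty: -/
@[route_item "route-BirchSwinnertonDyer-SchneiderFreeAdditiveX3", crux]
def HeegnerTwistData : Prop :=
  Literature.NumberTheory.EllipticCurves.friedbergHoffstein_exists_heegnerField_splitDivisors_twist_ne_zero → (∀ (W : WeierstrassCurve ℚ), Literature.NumberTheory.EllipticCurves.even_analyticRank_iff_rootNumber_eq_one W) → (∀ (W : WeierstrassCurve ℚ) (K : Type) [Field K] [NumberField K], Literature.NumberTheory.EllipticCurves.exists_isHeegnerPoint W K) → (∀ (N : ℕ) [NeZero N] (W : WeierstrassCurve ℚ) (K : Type) [Field K] [NumberField K], Literature.NumberTheory.EllipticCurves.gross_zagier N W K) → WeierstrassCurve.hasEntireLFunction_rat → Literature.NumberTheory.EllipticCurves.ModularForms.nonempty_modularParametrizationData → ∀ (W : WeierstrassCurve ℚ) [W.IsElliptic] [W.IsGloballyMinimal] (p : ℕ) [Fact p.Prime], W.analyticRank = 1 → p ≠ 2 → Literature.NumberTheory.EllipticCurves.Rank1Residual.ClassX3 W p → Summit.BirchSwinnertonDyer.Rank1Residual.Additive.SubSemistableTwist W p → Summit.BirchSwinnertonDyer.BirchSwinnertonDyer.Theorems.SchneiderFree.HeegnerTwistDataManinAt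 W p

-- `HeegnerTwistData` holds: proved by `Summit.BirchSwinnertonDyer.BirchSwinnertonDyer.Theorems.schneiderFreeAdditiveX3_heegnerTwistData_proof` (its module imports this route file, so no `_holds` link can be stated here).

/-- item stmt-BirchSwinnertonDyer-19184 · support · rank 9 · open · by planner
sources: GrossZagier1986, FriedbergHoffstein1995, Delbourgo1998, Wuthrich2014
[support] the inputs of `JointLowerManin`, `HeegnerTwistData` and `PartnerUpperRankZero` that are
VERBATIM IN PRINT, as ONE conjunction of thirteen named facts of the tree (in this order; `closes`
destructures it): Gross–Zagier I.(6.3) (`gross_zagier`), Kolyvagin (`kolyvagin`), GZK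
rank/finiteness (`rank_eq_analyticRank_of_analyticRank_le_one`), modularity
(`hasEntireLFunction_rat`), a modular parametrisation datum (`nonempty_modularParametrizationData`),
Cassels' isogeny invariance (`bsdRHS_eq_of_isIsogenous`), Gross–Zagier I.(7.3)
(`GrossZagier1986_thm_I_7_3`), Friedberg–Hoffstein Thm. B with prescribed splitting
(`friedbergHoffstein_exists_heegnerField_splitDivisors_twist_ne_zero`), the parity fact
(`even_analyticRank_iff_rootNumber_eq_one`), Heegner points over `K` (`exists_isHeegnerPoint`),
Delbourgo 1998 Prop. 4, Wuthrich 2014 Thm. 16 (half and component). Published theorems,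
unformalised; the item closes only by formalisation (pattern of route AdditiveBranchIMC's
`PrintedFacts`); every other item names the facts it consumes as explicit antecedents, so this item
is referenced by `closes` and `Assembly` only. [difficulty: open-problem] -/
@[route_item "route-BirchSwinnertonDyer-SchneiderFreeAdditiveX3", crux]
def PrintedFacts : Prop :=
  (∀ (N : ℕ) [NeZero N] (W : WeierstrassCurve ℚ) (K : Type) [Field K] [NumberField K], Literature.NumberTheory.EllipticCurves.gross_zagier N W K) ∧ (∀ (N : ℕ) [NeZero N] (W : WeierstrassCurve ℚ) (K : Type) [Field K] [NumberField K], Literature.NumberTheory.EllipticCurves.kolyvagin N W K) ∧ Literature.NumberTheory.EllipticCurves.rank_eq_analyticRank_of_analyticRank_le_one ∧ WeierstrassCurve.hasEntireLFunction_rat ∧ Literature.NumberTheory.EllipticCurves.ModularForms.nonempty_modularParametrizationData ∧ WeierstrassCurve.bsdRHS_eq_of_isIsogenous ∧ Literature.NumberTheory.EllipticCurves.GrossZagier1986_thm_I_7_3 ∧ Literature.NumberTheory.EllipticCurves.friedbergHoffstein_exists_heegnerField_splitDivisors_twist_ne_zero ∧ (∀ (W : WeierstrassCurve ℚ), Literature.NumberTheory.EllipticCurves.even_analyticRank_iff_rootNumber_eq_one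 W) ∧ (∀ (W : WeierstrassCurve ℚ) (K : Type) [Field K] [NumberField K], Literature.NumberTheory.EllipticCurves.exists_isHeegnerPoint W K) ∧ Literature.NumberTheory.EllipticCurves.Delbourgo1998.prop4_rankZero_pow_dvd_constantCoeff ∧ Literature.NumberTheory.EllipticCurves.Wuthrich2014.thm16_halfEigenCharIdeal_dvd_cyclotomicPrime ∧ Literature.NumberTheory.EllipticCurves.Wuthrich2014.charIdeal_dvd_padicLFunctionBranch_component

/-- item stmt-BirchSwinnertonDyer-19263 · support · rank 9 · closed · proved by Summit.BirchSwinnertonDyer.BirchSwinnertonDyer.Theorems.schneiderFreeAdditiveX3_stepLManinLinkR_proof (prover) · by planner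
[support] repaired StepLManinLink (rev 4, REPAIR DUTY class misstated): the same link
`PotMultBranchIMC → GordTwoBranchIMC → AnticycControlAdditive → StepLManin` with the Kolyvagin
conjunct of `PrintedFacts` prepended — door-c2 FINDING F2 (2026-08-26T02:49Z): as typed the link is
unprovable because `StepLManin`'s display uses `ord_p #Ш(E/K)` (shaOrder, junk 0 when infinite)
while the control socket counts `#Ш(E/K)[p^∞]`; passing between them needs the finiteness of
`Ш(E/K)` for a non-torsion Heegner point (Kolyvagin 1990 Thm. A; Gross 1991 Thm. 1.3), a cite_only
fact. PROVED modulo that fact: `Theorems.SchneiderFree.stepLManinLink_of_kolyvagin` (p418184,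
door-c2) — this item closes by the one-liner `fun hKo ↦ stepLManinLink_of_kolyvagin hKo`. `closes`
passes `hKo` (destructured from `PrintedFacts`). [difficulty: S] [sources: Kolyvagin1990; Gross1991
Thm 1.3; JetchevSkinnerWan2017 §7.4.1] -/
@[route_item "route-BirchSwinnertonDyer-SchneiderFreeAdditiveX3"]
def StepLManinLinkR : Prop :=
  (∀ (N : ℕ) [NeZero N] (W : WeierstrassCurve ℚ) (K : Type) [Field K] [NumberField K], Literature.NumberTheory.EllipticCurves.kolyvagin N W K) → PotMultBranchIMC → GordTwoBranchIMC → AnticycControlAdditive → StepLManin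

-- `StepLManinLinkR` holds: proved by `Summit.BirchSwinnertonDyer.BirchSwinnertonDyer.Theorems.schneiderFreeAdditiveX3_stepLManinLinkR_proof` (its module imports this route file, so no `_holds` link can be stated here).

/-- item stmt-BirchSwinnertonDyer-19266 · aside · rank 9 · open · by planner
[support] modularity of E/ℚ as parametrisation data (Breuil–Conrad–Diamond–Taylor 2001 Thm A), BY
NAME — conjunct of OrdPublishedInputsAtTwo (19149; Literature.Uncategorized.OrdPublishedInputsAtTwo
l.26); same content, filed so the head constant is item-stated (#15c one rule; cite_only dep) -/
@[route_item "route-BirchSwinnertonDyer-SchneiderFreeAdditiveX3"]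
def ModularParametrizationSupply : Prop :=
  Literature.NumberTheory.EllipticCurves.ModularForms.nonempty_modularParametrizationData

/-- item stmt-BirchSwinnertonDyer-19273 · aside · rank 9 · open · by planner
[support] entire continuation of L(E/ℚ, s) (modularity: Breuil–Conrad–Diamond–Taylor 2001 Thm A +
Hecke/Shimura), BY NAME — conjunct of MultConversePublishedInputsAtTwo (19185); same content, filed
so the head constant is item-stated (#15c one rule; cite_only dep) -/
@[route_item "route-BirchSwinnertonDyer-SchneiderFreeAdditiveX3"]
def EntireLFunctionRat : Prop :=
  WeierstrassCurve.hasEntireLFunction_rat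

/-- item stmt-BirchSwinnertonDyer-19296 · aside · rank 9 · open · by planner
[support] Wuthrich 2014 Thm 16 (p. 398): for an odd prime p and a character-eigen part, half the
χ-eigen characteristic ideal of the Selmer dual divides the cyclotomic prime (printed with E
semistable at p; read at an additive potentially ordinary p — audit sheet D-AUDIT-hW16) — conjunct
of the crux ReadingFacts (stmt-BirchSwinnertonDyer-19361), BY NAME; same content, filed as a split
child so the head constant is item-stated (gate5 #15c one rule; readiness rule 2026-08-15: cite_only
dep declared by the route; director-bsd 2026-08-26T04:22Z «K3/E2 shape»); the
reading-at-an-additive-prime caveat (referee A pub-bsdpct R244; cell audit sheets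
HOME/audit/D-AUDIT-*.md) stays recorded on the parent; no crux statement / closes / tribunal change -/
@[route_item "route-BirchSwinnertonDyer-SchneiderFreeAdditiveX3"]
def WuthrichHalfEigenDivisibility : Prop :=
  Literature.NumberTheory.EllipticCurves.Wuthrich2014.thm16_halfEigenCharIdeal_dvd_cyclotomicPrime

/-- item stmt-BirchSwinnertonDyer-19306 · aside · rank 9 · open · by operator
[support] Delbourgo 1998 Prop 4 (Compositio 113, p. 139), verbatim WEAK form: a p-power times the
BSD quotient divides the constant coefficient of the analytic p-adic L-function in analytic rank 0
at a bad (potentially ordinary / multiplicative) prime — conjunct of the support PrintedFacts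
(stmt-BirchSwinnertonDyer-19362), BY NAME; same content, filed as a split child so the head constant
is item-stated (gate5 #15c one rule; readiness rule 2026-08-15: cite_only dep declared by the route;
director-bsd 2026-08-26T04:22Z «K3/E2 shape»); no crux statement / closes / tribunal change -/
@[route_item "route-BirchSwinnertonDyer-SchneiderFreeAdditiveX3"]
def DelbourgoRankZeroDivisibility : Prop :=
  Literature.NumberTheory.EllipticCurves.Delbourgo1998.prop4_rankZero_pow_dvd_constantCoeff

/-- item stmt-BirchSwinnertonDyer-19307 · aside · rank 9 · open · by operator
[support] Cassels 1965 (Arithmetic on curves of genus 1, VIII; J. reine angew. Math. 217) / Milne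
ADT Thm I.7.3 and Rem I.7.4: the BSD quotient (right-hand side of the BSD formula) is invariant
under isogeny over ℚ — conjunct of the support PrintedFacts (stmt-BirchSwinnertonDyer-19362), BY
NAME; same content, filed as a split child so the head constant is item-stated (gate5 #15c one rule;
readiness rule 2026-08-15: cite_only dep declared by the route; director-bsd 2026-08-26T04:22Z
«K3/E2 shape»); no crux statement / closes / tribunal change -/
@[route_item "route-BirchSwinnertonDyer-SchneiderFreeAdditiveX3"]
def BSDQuotientIsogenyInvariance : Prop :=
  WeierstrassCurve.bsdRHS_eq_of_isIsogenous

/-- item stmt-BirchSwinnertonDyer-19369 · aside · rank 9 · open · by planner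
[aside] Gross–Zagier 1986 Thm. I.(7.3) (p. 231; proof V.§2 pp. 310–313): L′(E,1) ≠ 0 ⇒ a rational
point of infinite order (via a Heegner point and the GZ formula) — a cite_only dep of this route
reached through the depth-1 support item PublishedInputsIMCReduction
(stmt-BirchSwinnertonDyer-19283, child of 19061; a third item layer is forbidden, so it is
item-stated here as a by-name ASIDE: banked context, never staffed, BC6-exempt; gate5 02:15:40Z
«aside also counts»); no crux statement / closes / tribunal change -/
@[route_item "route-BirchSwinnertonDyer-SchneiderFreeAdditiveX3"]
def GrossZagierRationalPointI73 : Prop :=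
  Literature.NumberTheory.EllipticCurves.GrossZagier1986_thm_I_7_3

/-- item stmt-BirchSwinnertonDyer-19449 · aside · rank 9 · open · by planner
[aside] Friedberg–Hoffstein 1995 Thm. B (special case; with Waldspurger / Bump–Friedberg–Hoffstein):
a Heegner field K for N with prescribed primes SPLIT and L(E^{d_K},1) ≠ 0 (used by HeegnerTwistData
19183 to supply the B6 Heegner datum at an additive p) — a cite_only dep of this route
(deps.unproved, rev 6), item-stated here as a BY-NAME ASIDE so the route's dependency cone is
declared (gate5 02:15:40Z «aside also counts»; ErratumRoadFive 19369–19375 / K1 19303–19307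
precedent): banked context, never staffed, BC6-exempt, closes only by formalisation; no crux
statement / closes / tribunal / tribunal_fit change. Filed by the route base unit P2 g8 for
STAFFABLE (director-bsd 04:57:54Z E2). sources: FriedbergHoffstein1995, JetchevSkinnerWan2017 §7.4.1 -/
@[route_item "route-BirchSwinnertonDyer-SchneiderFreeAdditiveX3"]
def FriedbergHoffsteinHeegnerSplitDivisorsTwist : Prop :=
  Literature.NumberTheory.EllipticCurves.friedbergHoffstein_exists_heegnerField_splitDivisors_twist_ne_zero

/-- item stmt-BirchSwinnertonDyer-19450 · aside · rank 9 · open · by planner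
[aside] Wuthrich 2014 (reducible/Eisenstein p), divisibility of the cyclotomic p-adic L-function
branch by the characteristic ideal, ω^i-component form (p. 397) — consumed by PartnerUpperRankZero
19181 via PrintedFacts — a cite_only dep of this route (deps.unproved, rev 6), item-stated here as a
BY-NAME ASIDE so the route's dependency cone is declared (gate5 02:15:40Z «aside also counts»;
ErratumRoadFive 19369–19375 / K1 19303–19307 precedent): banked context, never staffed, BC6-exempt,
closes only by formalisation; no crux statement / closes / tribunal / tribunal_fit change. Filed by
the route base unit P2 g8 for STAFFABLE (director-bsd 04:57:54Z E2). sources: Wuthrich2014 -/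
@[route_item "route-BirchSwinnertonDyer-SchneiderFreeAdditiveX3"]
def WuthrichBranchComponentDivisibility : Prop :=
  Literature.NumberTheory.EllipticCurves.Wuthrich2014.charIdeal_dvd_padicLFunctionBranch_component

/-- item stmt-BirchSwinnertonDyer-19451 · aside · rank 9 · open · by planner
[aside] the cell-posited @[conjecture] predicate `SchneiderFree.AdditiveControlOnTreeAt`
(Theorems/SchneiderFreeSockets.lean: T-B6-2′, pointwise anticyclotomic control EQUALITY at an
additive prime, JSW17 Thm. 3.3.1 shape; nothing asserted) — item-stated as the POINTWISE UNFOLDING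
of the crux socket `AdditiveControlInputManinAt W p` (cruxes 19295 AnticycControlAdditiveK / 19178):
`InputManinAt W p → ∀ B6 data + frame, AdditiveControlOnTreeAt …` (definitionally `fun h => h`;
by-name ASIDE: banked context, never staffed, BC6-exempt) so the @[conjecture] leaf is declared
under the #15c rule (head of the conclusion under ∀/→); K3 precedent (ClassRecordThree 19405/19406).
Filed by base unit P2 g8 for STAFFABLE (director-bsd 04:57:54Z E1). sources: JetchevSkinnerWan2017,
Greenberg1999 -/
@[route_item "route-BirchSwinnertonDyer-SchneiderFreeAdditiveX3"]
def AdditiveControlLeaf : Prop :=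
  (∀ (N : ℕ) [NeZero N] (W : WeierstrassCurve ℚ) (K : Type) [Field K] [NumberField K], Literature.NumberTheory.EllipticCurves.kolyvagin N W K) → ∀ (W : WeierstrassCurve ℚ) [W.IsElliptic] [W.IsGloballyMinimal] (p : ℕ) [Fact p.Prime], W.analyticRank = 1 → p ≠ 2 → Literature.NumberTheory.EllipticCurves.Rank1Residual.ClassX3 W p → Summit.BirchSwinnertonDyer.Rank1Residual.Additive.SubSemistableTwist W p → ∀ (N : ℕ) [NeZero N] (K : Type) [Field K] [NumberField K] (Dt : Literature.NumberTheory.EllipticCurves.ModularForms.ModularParametrizationData W N) (H : Literature.NumberTheory.EllipticCurves.HeegnerDatum N (NumberField.discr K)) (ι : K →+* ℂ) (P : (W.baseChange K).toAffine.Point), W.analyticRank = 1 → Summit.BirchSwinnertonDyer.Rank1Residual.Additive.N10.Locus W p → W.conductorNorm ℤ = N → Literature.NumberTheory.EllipticCurves.IsImaginaryQuadratic K → Odd (NumberField.discr K) → ¬ p ∣ NumberField.Units.torsionOrder K → Literature.NumberTheory.EllipticCurves.SatisfiesHeegnerHypothesis N K → (W.quadraticTwist (NumberField.discr K : ℚ)).entireLFunction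 1 ≠ 0 → WeierstrassCurve.Affine.Point.map ι.toRatAlgHom P = Literature.NumberTheory.EllipticCurves.ModularForms.heegnerPointComplex Dt H → ¬ IsOfFinAddOrder P → ∀ (κ : Literature.NumberTheory.EllipticCurves.ZpExtension K p), κ.IsAnticyclotomic → ∀ (γ : Field.absoluteGaloisGroup K) [Fact (κ.IsTopGenerator γ)] (𝔭 : IsDedekindDomain.HeightOneSpectrum (NumberField.RingOfIntegers K)) (h𝔭 : ((p : ℕ) : NumberField.RingOfIntegers K) ∈ 𝔭.asIdeal) (he : 𝔭.asIdeal.ramificationIdx (NumberField.RingOfIntegers ℚ) = 1) (hf : 𝔭.asIdeal.inertiaDeg (NumberField.RingOfIntegers ℚ) = 1), Summit.BirchSwinnertonDyer.BirchSwinnertonDyer.Theorems.SchneiderFree.AdditiveControlOnTreeAt p κ 𝔭 γ (Summit.BirchSwinnertonDyer.Rank1Residual.X11b.embAt K p 𝔭 h𝔭 he hf) P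

/-- item stmt-BirchSwinnertonDyer-19452 · aside · rank 9 · open · by planner
[aside] the cell-posited @[conjecture] predicate `SchneiderFree.AdditiveIMCLowerBDPOnTreeLeAt`
(Theorems/SchneiderFreeSocketsV2.lean: T-B6-1 with slack s = v_p(c_φ), anticyclotomic IMC ⊇ + BDP
formula, JSW17 §7.4.1 / LZZ18 Thm. 1.8 shape; nothing asserted) — item-stated as the POINTWISE
UNFOLDING of the crux socket `AdditiveIMCLowerBDPInputManinAt W p` (cruxes 19176 PotMultBranchIMC /
19177 GordTwoBranchIMC): `InputManinAt W p → ∀ B6 data + frame, AdditiveIMCLowerBDPOnTreeLeAt …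
(padicValNat p Dt.c.natAbs) P` (definitionally `fun h => h`; by-name ASIDE: banked context, never
staffed, BC6-exempt) so the @[conjecture] leaf is declared under the #15c rule; K3 precedent
(ClassRecordThree 19405/19406). Filed by base unit P2 g8 for STAFFABLE (director-bsd 04:57:54Z E1).
sources: JetchevSkinnerWan2017, LiuZhangZhang2018 -/
@[route_item "route-BirchSwinnertonDyer-SchneiderFreeAdditiveX3"]
def AdditiveIMCLowerBDPLeaf : Prop :=
  ∀ (W : WeierstrassCurve ℚ) [W.IsElliptic] [W.IsGloballyMinimal] (p : ℕ) [Fact p.Prime], W.analyticRank = 1 → p ≠ 2 → Literature.NumberTheory.EllipticCurves.Rank1Residual.ClassX3 W p → Summit.BirchSwinnertonDyer.Rank1Residual.Additive.SubM W p → ∀ (N : ℕ) [NeZero N] (K : Type) [Field K] [NumberField K] (Dt : Literature.NumberTheory.EllipticCurves.ModularForms.ModularParametrizationData W N) (H : Literature.NumberTheory.EllipticCurves.HeegnerDatum N (NumberField.discr K)) (ι : K →+* ℂ) (P : (W.baseChange K).toAffine.Point), W.analyticRank = 1 → Summit.BirchSwinnertonDyer.Rank1Residual.Additive.N10.Locus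 W p → W.conductorNorm ℤ = N → Literature.NumberTheory.EllipticCurves.IsImaginaryQuadratic K → Odd (NumberField.discr K) → ¬ p ∣ NumberField.Units.torsionOrder K → Literature.NumberTheory.EllipticCurves.SatisfiesHeegnerHypothesis N K → (W.quadraticTwist (NumberField.discr K : ℚ)).entireLFunction 1 ≠ 0 → WeierstrassCurve.Affine.Point.map ι.toRatAlgHom P = Literature.NumberTheory.EllipticCurves.ModularForms.heegnerPointComplex Dt H → ¬ IsOfFinAddOrder P → ∀ (κ : Literature.NumberTheory.EllipticCurves.ZpExtension K p), κ.IsAnticyclotomic → ∀ (γ : Field.absoluteGaloisGroup K) [Fact (κ.IsTopGenerator γ)] (𝔭 : IsDedekindDomain.HeightOneSpectrum (NumberField.RingOfIntegers K)) (h𝔭 : ((p : ℕ) : NumberField.RingOfIntegers K) ∈ 𝔭.asIdeal) (he : 𝔭.asIdeal.ramificationIdx (NumberField.RingOfIntegers ℚ) = 1) (hf : 𝔭.asIdeal.inertiaDeg (NumberField.RingOfIntegers ℚ) = 1), Summit.BirchSwinnertonDyer.BirchSwinnertonDyer.Theorems.SchneiderFree.AdditiveIMCLowerBDPOnTreeLeAt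 p κ 𝔭 γ (Summit.BirchSwinnertonDyer.Rank1Residual.X11b.embAt K p 𝔭 h𝔭 he hf) (padicValNat p Dt.c.natAbs) P

/-- item stmt-BirchSwinnertonDyer-19538 · support · rank 9 · open · by planner
[support] facts binder (held, rank 9; P2 g9 rev 9, F2-class rule): the conjunction of the cite-only
Poitou–Tate / class-field-theory facts consumed by the control corner's closing proofs (door-c4 g2
FINDING-door-c4-g2.md, HANDOFF 06:40Z): (i) `poitouTate_selmerStructure_duality K` for every number
field K (Milne ADT I 4.10(b) / Howard 2004 Thm 2.1.11 / Rubin ES Thm 1.7.3); (ii)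
`poitouTate_sha_tateDual K` (Milne ADT I 4.10(a) / Harari 17.13); (iii) Brink 2007 Thm 2
`ZpExtension.decomp_not_le_kerSubgroup_of_isAnticyclotomic K p` (split primes away from p are
finitely decomposed in K^ac_∞); (iv) Brink 2007 Cor 1
`ZpExtension.decomp_not_le_kerSubgroup_above_of_isAnticyclotomic K p` (p429602; the primes above p
do not split completely in K^ac_∞). NOT included because they are TREE THEOREMS: the local
Euler–Poincaré characteristic (`localEulerPoincareCharacteristic_holds`, Rank1Residual/GaloisImage)
and cd_p ≤ 2 (`fieldCdLE_two_of_numberField_holds`); Kolyvagin stays in `PrintedFacts`. Consumed by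
`closes` and fed to `AnticycControlAdditiveKF`; never served. sources: MilneADT2006 I 2.8/4.10;
Howard2004HeegnerKolyvagin Thm 2.1.11; Brink2007 Thm 2, Cor 1; arXiv:1512.06894 §3.2–3.3. -/
@[route_item "route-BirchSwinnertonDyer-SchneiderFreeAdditiveX3", crux]
def ControlFacts : Prop :=
  (∀ (K : Type) [Field K] [NumberField K], Literature.NumberTheory.GaloisCohomology.poitouTate_selmerStructure_duality K) ∧ (∀ (K : Type) [Field K] [NumberField K], Literature.NumberTheory.GaloisCohomology.poitouTate_sha_tateDual K) ∧ (∀ (K : Type) [Field K] [NumberField K] (p : ℕ) [Fact p.Prime], Literature.NumberTheory.EllipticCurves.ZpExtension.decomp_not_le_kerSubgroup_of_isAnticyclotomic K p) ∧ (∀ (K : Type) [Field K] [NumberField K] (p : ℕ) [Fact p.Prime], Literature.NumberTheory.EllipticCurves.ZpExtension.decomp_not_le_kerSubgroup_above_of_isAnticyclotomic K p)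

/-- item stmt-BirchSwinnertonDyer-19544 · support · rank 9 · closed · proved by Summit.BirchSwinnertonDyer.BirchSwinnertonDyer.Theorems.SchneiderFreeAdditiveX3.stub_regimeA (prover) · by planner
[support] regime A of the control corner (rank 9; P2 g9 rev 9): the anticyclotomic control equality
`AdditiveControlOnTreeAt p κ 𝔭 γ (embAt K p 𝔭) P` at EVERY frame of the door (B6 ∩ X3 ∩ sst-twist,
r_an = 1, Heegner datum, anticyclotomic κ, degree-one 𝔭 ∣ p) WITH NO LOCAL p-TORSION
(`E(K̄)[p^∞]^{D_𝔭}[p] = 0`, i.e. t_p = 0: every p ≥ 5 cell but III@5/II@7 and the (3, e = 2) pairs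
without local 3-torsion — 42 % of the door's curves), stated under the facts (i)–(iii) of
`ControlFacts` and Kolyvagin as antecedents. = the registered v2-K stub
`stub_control_noLocalPTorsion` (signature verbatim) prefixed by the three facts; door-c4 g2 proved
exactly this modulo the facts (`stub_control_noLocalPTorsion_of_facts`, p426479 pending farm olean;
atoms p425528) — closes by a short bridge supplying `localEulerPoincareCharacteristic_holds` /
`fieldCdLE_two_of_numberField_holds`. why it might fail: it should not — only a mismatch between the
facts' quantifier forms here (∀ K) and door-c4's per-K hypotheses could cost lines, not truth.
sources: arXiv:1512.06894 Thm 3.3.1, Prop 3.2.1, Prop 3.3.4; arXiv:1704.06608 Thm 2.3; MilneADT2006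
I 4.10; Brink2007 Thm 2; FINDING-door-c4-g2.md (evidence n=11 on -/
@[route_item "route-BirchSwinnertonDyer-SchneiderFreeAdditiveX3"]
def ControlNoLocalPTorsionF : Prop :=
  (∀ (K : Type) [Field K] [NumberField K], Literature.NumberTheory.GaloisCohomology.poitouTate_selmerStructure_duality K) → (∀ (K : Type) [Field K] [NumberField K], Literature.NumberTheory.GaloisCohomology.poitouTate_sha_tateDual K) → (∀ (K : Type) [Field K] [NumberField K] (p : ℕ) [Fact p.Prime], Literature.NumberTheory.EllipticCurves.ZpExtension.decomp_not_le_kerSubgroup_of_isAnticyclotomic K p) → (∀ (N : ℕ) [NeZero N] (W : WeierstrassCurve ℚ) (K : Type) [Field K] [NumberField K], Literature.NumberTheory.EllipticCurves.kolyvagin N W K) → ∀ (W : WeierstrassCurve ℚ) [W.IsElliptic] [W.IsGloballyMinimal] (p : ℕ) [Fact p.Prime], W.analyticRank = 1 → p ≠ 2 → Literature.NumberTheory.EllipticCurves.Rank1Residual.ClassX3 W p → Summit.BirchSwinnertonDyer.Rank1Residual.Additive.SubSemistableTwist W p → ∀ (N : ℕ) [NeZero N] (K : Type) [Field K] [NumberField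 K] (Dt : Literature.NumberTheory.EllipticCurves.ModularForms.ModularParametrizationData W N) (H : Literature.NumberTheory.EllipticCurves.HeegnerDatum N (NumberField.discr K)) (ι : K →+* ℂ) (P : (W.baseChange K).toAffine.Point), W.analyticRank = 1 → Summit.BirchSwinnertonDyer.Rank1Residual.Additive.N10.Locus W p → WeierstrassCurve.conductorNorm ℤ W = N → Literature.NumberTheory.EllipticCurves.IsImaginaryQuadratic K → Odd (NumberField.discr K) → ¬ p ∣ NumberField.Units.torsionOrder K → Literature.NumberTheory.EllipticCurves.SatisfiesHeegnerHypothesis N K → (W.quadraticTwist (NumberField.discr K : ℚ)).entireLFunction 1 ≠ 0 → (WeierstrassCurve.Affine.Point.map ι.toRatAlgHom) P = Literature.NumberTheory.EllipticCurves.ModularForms.heegnerPointComplex Dt H → ¬ IsOfFinAddOrder P → ∀ (κ : Literature.NumberTheory.EllipticCurves.ZpExtension K p), κ.IsAnticyclotomic → ∀ (γ : Field.absoluteGaloisGroup K) [Fact (κ.IsTopGenerator γ)] (𝔭 : IsDedekindDomain.HeightOneSpectrum (NumberField.RingOfIntegers K)) (h𝔭 : ((p : ℕ) : NumberField.RingOfIntegers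 K) ∈ 𝔭.asIdeal) (he : 𝔭.asIdeal.ramificationIdx (NumberField.RingOfIntegers ℚ) = 1) (hf : 𝔭.asIdeal.inertiaDeg (NumberField.RingOfIntegers ℚ) = 1), (∀ m : (W.baseChange K).geomPrimaryTorsion p, (∀ d ∈ Literature.NumberTheory.EllipticCurves.GreenbergSelmer.decomp 𝔭, d • m = m) → p • m = 0 → m = 0) → Summit.BirchSwinnertonDyer.BirchSwinnertonDyer.Theorems.SchneiderFree.AdditiveControlOnTreeAt p κ 𝔭 γ (Summit.BirchSwinnertonDyer.Rank1Residual.X11b.embAt K p 𝔭 h𝔭 he hf) P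

-- `ControlNoLocalPTorsionF` holds: proved by `Summit.BirchSwinnertonDyer.BirchSwinnertonDyer.Theorems.SchneiderFreeAdditiveX3.stub_regimeA` (its module imports this route file, so no `_holds` link can be stated here).

/-- item stmt-BirchSwinnertonDyer-19545 · support · rank 9 · closed · proved by Summit.BirchSwinnertonDyer.BirchSwinnertonDyer.Theorems.SchneiderFreeAdditiveX3.controlNoGlobalPTorsionF_holds (prover) · by planner
[support] regime B1 of the control corner (rank 9; P2 g9 rev 9): the same control equality at every
frame WITH NO GLOBAL p-TORSION (`E(K)[p] = 0`, Mordell–Weil form `∀ x : E(K), p•x = 0 → x = 0`),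
GIVEN Fin_v on the cell (`SchneiderFreeControlAtoms.LocalTowerTorsionFiniteClaim W p` as a
hypothesis) and under the four facts of `ControlFacts` + Kolyvagin. door-c4 g2: proved modulo
exactly these (`additiveControlOnTreeAt_of_facts_of_localTowerTorsionFinite`, class-level
`anticycControlAdditive_noGlobalPTorsion_of_facts_of_claims`, RegimeB1.lean READY, proposes once
p427526's olean exists; ingredients landed: p427301 LocalKernelAtP (t = t_p ⇐ Fin_v +
non-splitting), p427508/p427526 torsion-robust reduction-type-free base count, p428257 PT surgery
without (iv)). why it might fail: it should not, modulo the hypothesis-form bridge (MW form ↔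
`E(K̄)[p^∞]^{Γ_K} = 0`, algebraicity of torsion `exists_pointsMapOfEmb_eq_of_nsmul_eq_zero`).
sources: arXiv:1512.06894 §3.3 Prop 3.3.4 Case 3(b); GreenbergLNM1716 Lemma 3.3; Brink2007 Cor 1;
FINDING-door-c4-g2.md §4. [difficulty: S–M] -/
@[route_item "route-BirchSwinnertonDyer-SchneiderFreeAdditiveX3"]
def ControlNoGlobalPTorsionF : Prop :=
  (∀ (K : Type) [Field K] [NumberField K], Literature.NumberTheory.GaloisCohomology.poitouTate_selmerStructure_duality K) → (∀ (K : Type) [Field K] [NumberField K], Literature.NumberTheory.GaloisCohomology.poitouTate_sha_tateDual K) → (∀ (K : Type) [Field K] [NumberField K] (p : ℕ) [Fact p.Prime], Literature.NumberTheory.EllipticCurves.ZpExtension.decomp_not_le_kerSubgroup_of_isAnticyclotomic K p) → (∀ (K : Type) [Field K] [NumberField K] (p : ℕ) [Fact p.Prime], Literature.NumberTheory.EllipticCurves.ZpExtension.decomp_not_le_kerSubgroup_above_of_isAnticyclotomic K p) → (∀ (N : ℕ) [NeZero N] (W : WeierstrassCurve ℚ) (K : Type) [Field K] [NumberField K], Literature.NumberTheory.EllipticCurves.kolyvagin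 N W K) → ∀ (W : WeierstrassCurve ℚ) [W.IsElliptic] [W.IsGloballyMinimal] (p : ℕ) [Fact p.Prime], W.analyticRank = 1 → p ≠ 2 → Literature.NumberTheory.EllipticCurves.Rank1Residual.ClassX3 W p → Summit.BirchSwinnertonDyer.Rank1Residual.Additive.SubSemistableTwist W p → (∀ (K : Type) [Field K] [NumberField K], Literature.NumberTheory.EllipticCurves.IsImaginaryQuadratic K → Summit.BirchSwinnertonDyer.Rank1Residual.X11b.SplitsIn K p → ∀ (κ : Literature.NumberTheory.EllipticCurves.ZpExtension K p), κ.IsAnticyclotomic → ∀ (𝔭 : IsDedekindDomain.HeightOneSpectrum (NumberField.RingOfIntegers K)), ((p : ℕ) : NumberField.RingOfIntegers K) ∈ 𝔭.asIdeal → (FixedPoints.addSubgroup ↥(Literature.NumberTheory.EllipticCurves.GreenbergSelmer.decomp 𝔭 ⊓ κ.kerSubgroup) ((W.baseChange K).geomPrimaryTorsion p) : Set ((W.baseChange K).geomPrimaryTorsion p)).Finite) → ∀ (N : ℕ) [NeZero N] (K : Type) [Field K] [NumberField K] (Dt : Literature.NumberTheory.EllipticCurves.ModularForms.ModularParametrizationData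 W N) (H : Literature.NumberTheory.EllipticCurves.HeegnerDatum N (NumberField.discr K)) (ι : K →+* ℂ) (P : (W.baseChange K).toAffine.Point), W.analyticRank = 1 → Summit.BirchSwinnertonDyer.Rank1Residual.Additive.N10.Locus W p → WeierstrassCurve.conductorNorm ℤ W = N → Literature.NumberTheory.EllipticCurves.IsImaginaryQuadratic K → Odd (NumberField.discr K) → ¬ p ∣ NumberField.Units.torsionOrder K → Literature.NumberTheory.EllipticCurves.SatisfiesHeegnerHypothesis N K → (W.quadraticTwist (NumberField.discr K : ℚ)).entireLFunction 1 ≠ 0 → (WeierstrassCurve.Affine.Point.map ι.toRatAlgHom) P = Literature.NumberTheory.EllipticCurves.ModularForms.heegnerPointComplex Dt H → ¬ IsOfFinAddOrder P → ∀ (κ : Literature.NumberTheory.EllipticCurves.ZpExtension K p), κ.IsAnticyclotomic → ∀ (γ : Field.absoluteGaloisGroup K) [Fact (κ.IsTopGenerator γ)] (𝔭 : IsDedekindDomain.HeightOneSpectrum (NumberField.RingOfIntegers K)) (h𝔭 : ((p : ℕ) : NumberField.RingOfIntegers K) ∈ 𝔭.asIdeal) (he : 𝔭.asIdeal.ramificationIdx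 (NumberField.RingOfIntegers ℚ) = 1) (hf : 𝔭.asIdeal.inertiaDeg (NumberField.RingOfIntegers ℚ) = 1), (∀ x : (W.baseChange K).toAffine.Point, p • x = 0 → x = 0) → Summit.BirchSwinnertonDyer.BirchSwinnertonDyer.Theorems.SchneiderFree.AdditiveControlOnTreeAt p κ 𝔭 γ (Summit.BirchSwinnertonDyer.Rank1Residual.X11b.embAt K p 𝔭 h𝔭 he hf) P

-- `ControlNoGlobalPTorsionF` holds: proved by `Summit.BirchSwinnertonDyer.BirchSwinnertonDyer.Theorems.SchneiderFreeAdditiveX3.controlNoGlobalPTorsionF_holds` (its module imports this route file, so no `_holds` link can be stated here).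

/-- item stmt-BirchSwinnertonDyer-19653 · support · rank 9 · closed · proved by Summit.BirchSwinnertonDyer.BirchSwinnertonDyer.Theorems.SchneiderFreeAdditiveX3.stepLManin_of_pt_of_kolyvagin_of_branchIMCs (prover) · by planner
sources: p448348
[support] rev 12 (P2 g11, base unit): the StepL link re-run in INEQUALITY form — Poitou–Tate
Selmer-structure duality (∀ K, cite-only PrintedFacts/ControlFacts conjunct) → Kolyvagin (∀ N W K,
cite-only) → PotMultBranchIMC (crux r2) → GordTwoBranchIMC (crux r3) → StepLManin (target r0). The
leaf consumes the control corner only via #Sel ≤ #(Λ/f_ac^Σ)_Γ·(torsion atoms ≤), which holds from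
PT duality + Kolyvagin alone (door-c4 g4 p447721
`Theorems/SchneiderFreeAdditiveX3ControlLeDoor.lean` + p448348 `…ControlLeMinimal.lean`, referee g24
PASS «r4/r5 OFF the leaf critical path»). This item's signature IS the type of the landed theorem
`Summit.BirchSwinnertonDyer.BirchSwinnertonDyer.Theorems.SchneiderFreeAdditiveX3.stepLManin_of_pt_of_kolyvagin_of_branchIMCs`
(p448348; exact match kernel-checked in the planner folder rev12/SigCheck.lean, rc 0) ⇒ closes BY
NAME; it replaces `StepLManinLinkR` (19263, closed) + `AnticycControlAdditiveKF` (19548, the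
exact-count EQUALITY, now a record) as binders of `closes`. why it might fail: it should not —
already proved in the tree; only a by-name close mismatch could delay it. [difficulty: provable-now]
sources: p447721, p448348 (door-c4 g4); MazurRubi -/
@[route_item "route-BirchSwinnertonDyer-SchneiderFreeAdditiveX3", crux]
def StepLManinLinkLe : Prop :=
  (∀ (K : Type) [Field K] [NumberField K], Literature.NumberTheory.GaloisCohomology.poitouTate_selmerStructure_duality K) → (∀ (N : ℕ) [NeZero N] (W : WeierstrassCurve ℚ) (K : Type) [Field K] [NumberField K], Literature.NumberTheory.EllipticCurves.kolyvagin N W K) → PotMultBranchIMC → GordTwoBranchIMC → StepLManin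

-- `StepLManinLinkLe` holds: proved by `Summit.BirchSwinnertonDyer.BirchSwinnertonDyer.Theorems.SchneiderFreeAdditiveX3.stepLManin_of_pt_of_kolyvagin_of_branchIMCs` (its module imports this route file, so no `_holds` link can be stated here).

/-- item stmt-BirchSwinnertonDyer-19662 · support · rank 9 · open · by planner
why it might fail: Two preprint layers (KY24b Thm 3.5.1 over KY24 over an in-proof generalisation of JLZ21); p = 3: LV16's p ∤ 6N′φ(N′)c_f dropped silently by KY24/KY24b (2 411 of 2 560 pairs); ⊇ is isogeny-robust only given μ = 0 on one lattice (p442145 transport); one frame with Ch ⊄ (L) refutes it.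
sources: arXiv:2410.23241, arXiv:2402.12781, arXiv:1704.06608, arXiv:1505.08165, door-c3-g4-hypothesis-audit.md (evidence n=7 on stmt-BirchSwinnertonDyer-19177)
[support · layer 2 of crux r3 GordTwoBranchIMC (stmt-BirchSwinnertonDyer-19177), requested by its
base seat door-c3 g4] H3 on the (G-ord, e = 2) cell: at every door datum of B6 ∩ X3 ∩ sst-twist with
r_an = 1, p odd, SubGordTwo, and every anticyclotomic frame (κ, γ, 𝔭 | p of degree one), EVERY BDP
frame (ι′ inducing 𝔭, Ω_K ≠ 0, Ω_p ≠ 0, L ∈ R₀⟦T⟧ with IsBDPLFunction for the datum's newform Dt.f)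
satisfies Ch_Λ(X_ac^∅(E_K[p^∞]))·R₀⟦T⟧ ⊆ (L). This is ‹Theorems.SchneiderFree.BranchIMCDivAt W p›
UNFOLDED (Iff.rfl, folder SigDefeq.lean rc 0) = Keller–Yin arXiv:2410.23241 Thm 3.5.1 (Char_Λ(𝔛)Λ^ur
= (𝓛_ε), Case I: p ∤ N′, p split, p > 2) read at the frame — PREPRINT, nothing in print; hypothesis
audit (G1)–(G6) = evidence n=7 on 19177 (door-c3 g4). With the typed halves H1/H2 (stubs
stub_bdpExistsSubG / stub_bdpValueLeSubG of the 19177 skeleton «typed-halves», derivable from print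
modulo typer facts CH18 Thm 5.7 + Lemma 5.4, BDP13 5.13, GZ86 I(6.3), Cai–Shu–Tian 1.1 — door-c3
g2/g3 Rebase road) + ControlFacts + AnticycControlAdditiveKF it closes 19177 BY NAME via
gordTwoBranchIMC_of_controlFacts_of_anticycControlAdditiveKF_of_typedHalves (p438916).
Conjecture-class residual (human rule 4b: -/
@[route_item "route-BirchSwinnertonDyer-SchneiderFreeAdditiveX3"]
def GordTwoBranchIMCDivX3 : Prop :=
  ∀ (W : WeierstrassCurve ℚ) [W.IsElliptic] [W.IsGloballyMinimal] (p : ℕ) [Fact p.Prime], W.analyticRank = 1 → p ≠ 2 → Literature.NumberTheory.EllipticCurves.Rank1Residual.ClassX3 W p → Summit.BirchSwinnertonDyer.Rank1Residual.Additive.SubGordTwo W p → ∀ (N : ℕ) [NeZero N] (K : Type) [Field K] [NumberField K] (Dt : Literature.NumberTheory.EllipticCurves.ModularForms.ModularParametrizationData W N) (H : Literature.NumberTheory.EllipticCurves.HeegnerDatum N (NumberField.discr K)) (ι : K →+* ℂ) (P : (W.baseChange K).toAffine.Point), W.analyticRank = 1 → Summit.BirchSwinnertonDyer.Rank1Residual.Additive.N10.Locus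 W p → WeierstrassCurve.conductorNorm ℤ W = N → Literature.NumberTheory.EllipticCurves.IsImaginaryQuadratic K → Odd (NumberField.discr K) → ¬ p ∣ NumberField.Units.torsionOrder K → Literature.NumberTheory.EllipticCurves.SatisfiesHeegnerHypothesis N K → (W.quadraticTwist (NumberField.discr K : ℚ)).entireLFunction 1 ≠ 0 → (WeierstrassCurve.Affine.Point.map ι.toRatAlgHom) P = Literature.NumberTheory.EllipticCurves.ModularForms.heegnerPointComplex Dt H → ¬ IsOfFinAddOrder P → ∀ (κ : Literature.NumberTheory.EllipticCurves.ZpExtension K p), κ.IsAnticyclotomic → ∀ (γ : Field.absoluteGaloisGroup K) [Fact (κ.IsTopGenerator γ)] (𝔭 : IsDedekindDomain.HeightOneSpectrum (NumberField.RingOfIntegers K)), ((p : ℕ) : NumberField.RingOfIntegers K) ∈ 𝔭.asIdeal → 𝔭.asIdeal.ramificationIdx (NumberField.RingOfIntegers ℚ) = 1 → 𝔭.asIdeal.inertiaDeg (NumberField.RingOfIntegers ℚ) = 1 → ∀ (ι' : PadicAlgCl p ≃+* ℂ), (∀ (w : NumberField.InfinitePlace K) (k : NumberField.RingOfIntegers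 K), k ∈ 𝔭.asIdeal ↔ ‖ι'.symm (w.embedding (k : K))‖ < 1) → ∀ (ΩK : ℂ) (Ωp : ℂ_[p]) (L : Literature.NumberTheory.EllipticCurves.UnrSeries p), ΩK ≠ 0 → Ωp ≠ 0 → Literature.NumberTheory.EllipticCurves.IsBDPLFunction ι' 𝔭 κ γ Dt.f ΩK Ωp L → (Summit.BirchSwinnertonDyer.Rank1Residual.X11b.AcSelmer.XAc.charIdeal (W.baseChange K) p κ 𝔭 ∅ γ).map (PowerSeries.map (Summit.BirchSwinnertonDyer.Rank1Residual.X11b.Halves.toUnr p)) ≤ Ideal.span {L}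

/-- item stmt-BirchSwinnertonDyer-19921 · aside · rank 9 · open · by operator
[support] The one PUBLISHED input the halves-glue consumes: Gross–Zagier–Kolyvagin, rank = analytic
rank for analytic rank ≤ 1 with Ш finite (tree named fact
rank_eq_analyticRank_of_analyticRank_le_one; used by bsdp_of_missingPPartAt to turn Miller's last
clause into BSD(E,2)). Carried as a displayed PUB hypothesis; never counted as progress. The further
PRINT of the roads to the two halves (Greenberg Thm-4.1 analogues at a multiplicative prime
thm41Analogue_charValue_rankZero_numberField_anyPrime / …_split_baseChange_anyPrime, modularity) and
the referee-passed MEMO inputs (Kato ⊗ℚ at a multiplicative 2: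
X5.O1.KatoMultiplicativeDivisibilityRat W 2, HOME mult/PROOF-MULT.md RC-2; Greenberg–Stevens at 2:
greenberg_stevens W 2, mult/PROOF-GS2.md RC-4) enter the LINES under the halves (bridge
multiplicativeRankZeroAtTwo_of_muRoad, p409679), not this glue. -/
@[route_item "route-BirchSwinnertonDyer-SchneiderFreeAdditiveX3"]
def MultPublishedInputsAtTwo : Prop :=
  Literature.NumberTheory.EllipticCurves.rank_eq_analyticRank_of_analyticRank_le_one

-- earlier Assembly (stmt-BirchSwinnertonDyer-18974, replaced 2026-08-26T01:23:55Z -> stmt-BirchSwinnertonDyer-19182): retired by None — BranchMCPotMult → BranchMCPotGoodTwo → AdditiveAnticycControl → StepLLink → HeegnerTwistChoice → JointLowerOfStepL → PartnerUpperX3RankZero → Summit.BirchSwinnertonDyer.BirchSwinnertonDyer.Theorems.SchneiderFree.AdditiveX3RankOneLower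
/-- item stmt-BirchSwinnertonDyer-19182 · assembly · rank 1 · closed · proved by Summit.BirchSwinnertonDyer.BirchSwinnertonDyer.Theorems.schneiderFreeAdditiveX3_assembly_proof (prover) · by planner
sources: Miller2011LMS
[assembly] PrintedFacts → PotMultBranchIMC → GordTwoBranchIMC → AnticycControlAdditive →
StepLManinLink → HeegnerTwistData → JointLowerManin → PartnerUpperRankZero → the rung leaf
AdditiveX3RankOneLower -/
@[route_item "route-BirchSwinnertonDyer-SchneiderFreeAdditiveX3"]
def Assembly : Prop :=
  PrintedFacts → PotMultBranchIMC → GordTwoBranchIMC → AnticycControlAdditive → StepLManinLink → HeegnerTwistData → JointLowerManin → PartnerUpperRankZero → Summit.BirchSwinnertonDyer.BirchSwinnertonDyer.Theorems.SchneiderFree.AdditiveX3RankOneLower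

-- `Assembly` holds: proved by `Summit.BirchSwinnertonDyer.BirchSwinnertonDyer.Theorems.schneiderFreeAdditiveX3_assembly_proof` (its module imports this route file, so no `_holds` link can be stated here).

-- records of items no longer active in this route (dropped / restated):
-- earlier StepLOnCells (stmt-BirchSwinnertonDyer-18966, replaced 2026-08-26T01:23:55Z -> stmt-BirchSwinnertonDyer-19175): retired by None — ∀ (W : WeierstrassCurve ℚ) [W.IsElliptic] [W.IsGloballyMinimal] (p : ℕ) [Fact p.Prime], W.analyticRank = 1 → p ≠ 2 → Literature.NumberTheory.EllipticCurves.Rank1Residual.ClassX3 W p → Summit.BirchSwinnertonDyer.Rank1Residual.Additive.SubSemistableTwist W p → Sum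
-- earlier BranchMCPotMult (stmt-BirchSwinnertonDyer-18967, replaced 2026-08-26T01:23:55Z -> stmt-BirchSwinnertonDyer-19176): retired by None — ∀ (W : WeierstrassCurve ℚ) [W.IsElliptic] [W.IsGloballyMinimal] (p : ℕ) [Fact p.Prime], W.analyticRank = 1 → p ≠ 2 → Literature.NumberTheory.EllipticCurves.Rank1Residual.ClassX3 W p → Summit.BirchSwinnertonDyer.Rank1Residual.Additive.SubM W p → Summit.BirchSw
-- earlier BranchMCPotGoodTwo (stmt-BirchSwinnertonDyer-18968, replaced 2026-08-26T01:23:55Z -> stmt-BirchSwinnertonDyer-19177): retired by None — ∀ (W : WeierstrassCurve ℚ) [W.IsElliptic] [W.IsGloballyMinimal] (p : ℕ) [Fact p.Prime], W.analyticRank = 1 → p ≠ 2 → Literature.NumberTheory.EllipticCurves.Rank1Residual.ClassX3 W p → Summit.BirchSwinnertonDyer.Rank1Residual.Additive.SubGordTwo W p → Summi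
-- earlier AdditiveAnticycControl (stmt-BirchSwinnertonDyer-18969, replaced 2026-08-26T01:23:55Z -> stmt-BirchSwinnertonDyer-19178): retired by None — ∀ (W : WeierstrassCurve ℚ) [W.IsElliptic] [W.IsGloballyMinimal] (p : ℕ) [Fact p.Prime], W.analyticRank = 1 → p ≠ 2 → Literature.NumberTheory.EllipticCurves.Rank1Residual.ClassX3 W p → Summit.BirchSwinnertonDyer.Rank1Residual.Additive.SubSemistableTwist
-- earlier StepLLink (stmt-BirchSwinnertonDyer-18970, replaced 2026-08-26T01:23:55Z -> stmt-BirchSwinnertonDyer-19179): retired by None — BranchMCPotMult → BranchMCPotGoodTwo → AdditiveAnticycControl → StepLOnCells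
-- earlier JointLowerOfStepL (stmt-BirchSwinnertonDyer-18972, replaced 2026-08-26T01:23:55Z -> stmt-BirchSwinnertonDyer-19180): retired by None — Summit.BirchSwinnertonDyer.BirchSwinnertonDyer.Theorems.SchneiderFree.JointLowerOfStepL
-- earlier PartnerUpperX3RankZero (stmt-BirchSwinnertonDyer-18973, replaced 2026-08-26T01:23:55Z -> stmt-BirchSwinnertonDyer-19181): retired by None — ∀ (Wd : WeierstrassCurve ℚ) [Wd.IsElliptic] [Wd.IsGloballyMinimal] (p : ℕ) [Fact p.Prime], Wd.analyticRank = 0 → p ≠ 2 → Literature.NumberTheory.EllipticCurves.Rank1Residual.ClassX3 Wd p → Summit.BirchSwinnertonDyer.Rank1Residual.Additive.SubSemistable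

/-! D-0027 §2.1 — DECIDING THEOREM (planner-authored via `route open/edit --closes-file`; by planner-bsd-schneider-ideate-P2-g11-0 2026-08-26T14:25:58Z):
its hypotheses are this route's items and its conclusion the registered leaf `Summit.BirchSwinnertonDyer.BirchSwinnertonDyer.Theorems.SchneiderFree.AdditiveX3RankOneLower` (rung K1, D-0061) (glue_lint), and it elaborates with this file. -/

@[closes "route-BirchSwinnertonDyer-SchneiderFreeAdditiveX3"] theorem closes (hF : PrintedFacts) (hCF : ControlFacts) (h2 : PotMultBranchIMC) (h3 : GordTwoBranchIMC)
    (hL : StepLManinLinkLe) (hK : HeegnerTwistData) (hJ : JointLowerManin) (hU : PartnerUpperRankZero) :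
    Summit.BirchSwinnertonDyer.BirchSwinnertonDyer.Theorems.SchneiderFree.AdditiveX3RankOneLower := by
  obtain ⟨hGZ, hKo, hGZK, hmod, hmodD, hCas, hGZ73, hFH, hpar, hHP, hDel, hW16, hWu⟩ := hF
  obtain ⟨hPT, -, -, -⟩ := hCF
  intro W _ _ p _ hr hp2 hX hS
  have hstep : Summit.BirchSwinnertonDyer.BirchSwinnertonDyer.Theorems.SchneiderFree.AdditiveStepLInputManinAt W p :=
    hL hPT hKo h2 h3 W p hr hp2 hX hS
  have hdata : Summit.BirchSwinnertonDyer.BirchSwinnertonDyer.Theorems.SchneiderFree.HeegnerTwistDataManinAt W p := hK hFH hpar hHP hGZ hmod hmodD W p hr hp2 hX hS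
  obtain ⟨N, _, K, _, _, Dt, H, ι, P, Wd, _, _, hN, hKiq, hodd, hunit, hHe, hLtw, hP, hnt, hWd,
    hrd, hXd, hSd⟩ := hdata
  have hloc : Summit.BirchSwinnertonDyer.Rank1Residual.Additive.N10.Locus W p :=
    (Summit.BirchSwinnertonDyer.Rank1Residual.Additive.N10.locus_iff_cells W p).mpr
      ((Summit.BirchSwinnertonDyer.Rank1Residual.Additive.N10.cellM_or_cellGordTwo_of_classX3_of_subSemistableTwist
          W p hp2 hX hS).elim Or.inl (fun h ↦ Or.inr (Or.inl h)))
  have hidx : Summit.BirchSwinnertonDyer.BirchSwinnertonDyer.Theorems.SchneiderFree.IndexLowerBoundLeAt W p K P (padicValNat p Dt.c.natAbs) :=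
    hstep N K Dt H ι P hr hloc hN hKiq hodd hunit hHe hLtw hP hnt
  have hJ' : Literature.NumberTheory.EllipticCurves.Rank1Residual.Typed.JointLowerBoundAt W Wd p :=
    hJ hGZ hKo hGZK hmod hmodD hCas hGZ73 W p N K Dt H ι P Wd hr hN hKiq hodd hunit hHe hLtw hP hnt hWd hrd hp2 hidx
  exact Literature.NumberTheory.EllipticCurves.Rank1Residual.Typed.missingLowerBoundAt_of_joint_of_upper hJ'
    (hU hDel hGZK hmod hmodD hW16 hWu Wd p hrd hp2 hXd hSd)

end Summit.BirchSwinnertonDyer.BirchSwinnertonDyer.Theses.SchneiderFreeAdditiveX3
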